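import Literature.Analysis.FluidPDE.ConstantinSmallViscositySlice
import Literature.Analysis.FluidPDE.NSVorticityBKMEnergy
import Literature.Analysis.FluidPDE.NSVorticityBKMSlice
import HarnessLib

/-!
# Constantin's small-viscosity comparison theorem, III: the integrated energy inequality

Analysis/FluidPDE support file (theorems only, no definitions, no named facts), the third of the
files proving the named fact `Literature.Analysis.FluidPDE.constantin_small_viscosity`
(P. Constantin, Comm. Math. Phys. 104 (1986), Thm. 1.1), in dimension three.

* **Closure by the Sobolev imbedding** (`constantin_dnorm_le_sobolev_total`,
  `constantin_trilinear_le`): the trilinear terms `∫χ|∇ᵏwⱼ||∇^{n-k+1}wᵢ||∂^α wᵢ|` of the slice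
  inequality close in the total level energy `Y_M = ∑_{m≤M} ∫∑ᵢ|∇ᵐwᵢ|²` as `3^(M+1) K Y_M^{3/2}`
  when `M ≥ 4` — the factor with at most `M − 2` derivatives is taken in the sup norm
  (`W^{2,2}(ℝ³) ⊂ C_B`, part I), the other two in `L²`. This is where Constantin's `m ≥ 3` enters;
  running the energy method at level `M = m + 1 ≥ 4` avoids the Gagliardo–Nirenberg/`L⁴`
  estimate needed at `m = 3` (the Euler solution has all Sobolev norms bounded, so one more
  level costs nothing).
* **The closed and the total slice inequality** (`constantin_slice_word_pairing_closed_le`,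
  `constantin_slice_total_pairing_le`): (1.10) localised, summed over all words `α` of length
  `n ≤ M`: `≤ A_R·E + νA√Y + BY + K'(√Y)³` with constants depending only on `M`, the bounds of
  the Euler slice and the Sobolev constant.
* **Time** (`constantin_timeDerivWithin_ipderiv_sub_eq`, `constantin_sum_integral_cutoff_sq_eq`,
  `constantin_levels_le_lintegral`): for a classical Navier–Stokes solution `(u, p)` (`ν ≥ 0`)
  and a classical Euler solution `(U, P)` on `[0, S] × ℝ³` in the Beale–Kato–Majda class with the
  same datum, the time derivatives of `∂^α(uᵢ − Uᵢ)` are given by the equations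
  (`EnergyToolkit`), the localised energies obey the fundamental theorem of calculus, the pressures
  are normalised at interior times by the tree's `pressure_sub_pressurePotential_eq` (valid for
  `ν ≥ 0`, hence for both solutions), the cutoff errors are `O(1/R)` uniformly on the slab by the
  class bounds, and `R → ∞` gives the integrated inequality
  `Y_M(t) ≤ 2∫₀ᵗ (νA√Y + BY + K'(√Y)³)` (lower Lebesgue integral of the majorant; no measurability
  of `Y` in time is needed), Constantin's (1.10)–(1.11) integrated from `w(0) = 0`.

## Mathlib / tree search

Tree (used): parts I–II (`ConstantinSmallViscosityCalculus`, `ConstantinSmallViscositySlice`);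
`pressure_sub_pressurePotential_eq`, `normalisedPressure_eq_pressurePotential`,
`integral_normalisedPressure_sq_le_of_bound`, `aestronglyMeasurable_normalisedPressure_of_integrable`,
`levelSq_bounds_of_hasBoundedSobolevNormsOn`, `exists_forall_norm_iteratedFDeriv_le_bkmClass`,
`tendsto_integral_cutoff_pow_mul_atTop`, `integral_le_toReal_lintegral_ofReal` (`NSVorticityBKMEnergy`,
`NSVorticityBKMTools`, `NSVorticityBKMSlice`, `NormalisedPressure*`); `IsSmoothSpaceTimeOn.integral_Ioo_integral_mul_timeDerivWithin_mul`,
`timeDerivWithin_ipderiv_slice`, `timeDerivWithin_fun_sub` (`EnergyToolkit`);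
`IsClassicalNSSolutionOn.timeDerivWithin_comp_eq`, `sum_pderiv_comp_eq_zero` (`NSVorticityEnergy`).
`lean search 'levels_le_lintegral|slice_total'`: none before this file.

## References

* P. Constantin, Comm. Math. Phys. 104 (1986), 311–326, §1, (1.7)–(1.11). [Constantin1986]
* R. A. Adams, *Sobolev Spaces* (1975), Thm. 5.4 Part I Case C. [Adams1975]
-/

noncomputable section

open MeasureTheory Set Function Filter
open scoped ENNReal NNReal ContDiff BigOperators Topology

namespace Literature.Analysis.FluidPDE
/-! ## Closing the trilinear terms by the Sobolev imbedding (dimension three) -/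

section Closure

/-- `∫ |∇ˡ(∂^β f)|² ≤ ∫ |∇^{l+k} f|²` for a word `β` of length `k`. [folklore] -/
theorem constantin_integral_dnormSq_ipderiv_le {f : EuclideanSpace ℝ (Fin 3) → ℝ} (hf : ContDiff ℝ ∞ f) (l : ℕ) {k : ℕ}
    (β : Fin k → Fin 3) (hI : Integrable (dnormSq (l + k) f) (volume : Measure (EuclideanSpace ℝ (Fin 3)))) :
    ∫ x, dnormSq l (ipderiv β f) x ≤ ∫ x, dnormSq (l + k) f x :=
  integral_mono (integrable_dnormSq_ipderiv hf l β hI) hI fun x => dnormSq_ipderiv_le hf l β x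

/-- **Sup bound of a word derivative by level integrals** (Sobolev imbedding in coordinates):
`|∂^β wⱼ (x)| ≤ K ∑_{l<3} (∫ ∑ᵢ |∇^{l+k} wᵢ|²)^{1/2}`, `|β| = k`, with `K` the constant of
`exists_abs_le_sobolev_dnormSq`. [cite: Adams1975, Thm. 5.4 Part I Case C (mp > n)] -/
theorem constantin_abs_ipderiv_le_sobolev_levels {K : ℝ} (hK0 : 0 ≤ K)
    (hK : ∀ f : EuclideanSpace ℝ (Fin 3) → ℝ, ContDiff ℝ ∞ f →
      (∀ j ∈ Finset.range 3, Integrable (dnormSq j f) (volume : Measure (EuclideanSpace ℝ (Fin 3)))) →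
      ∀ x, |f x| ≤ K * ∑ j ∈ Finset.range 3, Real.sqrt (∫ y, dnormSq j f y))
    {w : Fin 3 → EuclideanSpace ℝ (Fin 3) → ℝ} (hw : ∀ i, ContDiff ℝ ∞ (w i))
    (hI : ∀ m, Integrable (fun x => ∑ i, dnormSq m (w i) x) (volume : Measure (EuclideanSpace ℝ (Fin 3))))
    {k : ℕ} (β : Fin k → Fin 3) (j : Fin 3) (x : EuclideanSpace ℝ (Fin 3)) :
    |ipderiv β (w j) x| ≤ K * ∑ l ∈ Finset.range 3, Real.sqrt (∫ y, ∑ i, dnormSq (l + k) (w i) y) := by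
  have hIj : ∀ m, Integrable (dnormSq m (w j)) (volume : Measure (EuclideanSpace ℝ (Fin 3))) ∧
      ∫ y, dnormSq m (w j) y ≤ ∫ y, ∑ i, dnormSq m (w i) y := fun m => constantin_integrable_dnormSq_of_sum hw m (hI m) j
  have hint : ∀ l ∈ Finset.range 3, Integrable (dnormSq l (ipderiv β (w j))) (volume : Measure (EuclideanSpace ℝ (Fin 3))) :=
    fun l _ => integrable_dnormSq_ipderiv (hw j) l β (hIj (l + k)).1
  refine (hK (ipderiv β (w j)) (contDiff_ipderiv (hw j) β) hint x).trans ?_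
  refine mul_le_mul_of_nonneg_left (Finset.sum_le_sum fun l _ => Real.sqrt_le_sqrt ?_) hK0
  exact (constantin_integral_dnormSq_ipderiv_le (hw j) l β (hIj (l + k)).1).trans (hIj (l + k)).2

/-- **Sup bound of the coordinate norm `|∇ᵏwⱼ|` by level integrals**:
`|∇ᵏwⱼ (x)| ≤ 3ᵏ K ∑_{l<3} (∫ ∑ᵢ |∇^{l+k} wᵢ|²)^{1/2}`. [cite: Adams1975, Thm. 5.4 Part I Case C (mp > n)] -/
theorem constantin_dnorm_le_sobolev_levels {K : ℝ} (hK0 : 0 ≤ K)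
    (hK : ∀ f : EuclideanSpace ℝ (Fin 3) → ℝ, ContDiff ℝ ∞ f →
      (∀ j ∈ Finset.range 3, Integrable (dnormSq j f) (volume : Measure (EuclideanSpace ℝ (Fin 3)))) →
      ∀ x, |f x| ≤ K * ∑ j ∈ Finset.range 3, Real.sqrt (∫ y, dnormSq j f y))
    {w : Fin 3 → EuclideanSpace ℝ (Fin 3) → ℝ} (hw : ∀ i, ContDiff ℝ ∞ (w i))
    (hI : ∀ m, Integrable (fun x => ∑ i, dnormSq m (w i) x) (volume : Measure (EuclideanSpace ℝ (Fin 3))))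
    (k : ℕ) (j : Fin 3) (x : EuclideanSpace ℝ (Fin 3)) :
    dnorm k (w j) x ≤ 3 ^ k * K * ∑ l ∈ Finset.range 3, Real.sqrt (∫ y, ∑ i, dnormSq (l + k) (w i) y) := by
  calc dnorm k (w j) x ≤ ∑ β : Fin k → Fin 3, |ipderiv β (w j) x| := dnorm_le_sum_abs_ipderiv k _ x
    _ ≤ ∑ _β : Fin k → Fin 3, K * ∑ l ∈ Finset.range 3, Real.sqrt (∫ y, ∑ i, dnormSq (l + k) (w i) y) :=
        Finset.sum_le_sum fun β _ => constantin_abs_ipderiv_le_sobolev_levels hK0 hK hw hI β j x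
    _ = 3 ^ k * K * ∑ l ∈ Finset.range 3, Real.sqrt (∫ y, ∑ i, dnormSq (l + k) (w i) y) := by
        rw [Finset.sum_const, Finset.card_univ, Fintype.card_fun, Fintype.card_fin, Fintype.card_fin, nsmul_eq_mul]
        push_cast
        ring

/-- A level integral is bounded by the sum of the level integrals up to `M`. [folklore] -/
theorem constantin_level_le_sum_levels {w : Fin 3 → EuclideanSpace ℝ (Fin 3) → ℝ} {M m : ℕ} (hm : m ≤ M) :
    (∫ x, ∑ i, dnormSq m (w i) x) ≤ ∑ m' ∈ Finset.range (M + 1), ∫ x, ∑ i, dnormSq m' (w i) x :=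
  Finset.single_le_sum (f := fun m' => ∫ x, ∑ i, dnormSq m' (w i) x)
    (fun _ _ => integral_nonneg fun _ => Finset.sum_nonneg fun _ _ => dnormSq_nonneg _ _ _)
    (Finset.mem_range.2 (Nat.lt_succ_of_le hm))

/-- **Sup bound by the total level `Y_M`**: for `k + 2 ≤ M`,
`|∇ᵏwⱼ (x)| ≤ 3^{k+1} K √Y_M`, `Y_M = ∑_{m ≤ M} ∫ ∑ᵢ |∇ᵐwᵢ|²`. [cite: Adams1975, Thm. 5.4 Part I Case C (mp > n)] -/
theorem constantin_dnorm_le_sobolev_total {K : ℝ} (hK0 : 0 ≤ K)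
    (hK : ∀ f : EuclideanSpace ℝ (Fin 3) → ℝ, ContDiff ℝ ∞ f →
      (∀ j ∈ Finset.range 3, Integrable (dnormSq j f) (volume : Measure (EuclideanSpace ℝ (Fin 3)))) →
      ∀ x, |f x| ≤ K * ∑ j ∈ Finset.range 3, Real.sqrt (∫ y, dnormSq j f y))
    {w : Fin 3 → EuclideanSpace ℝ (Fin 3) → ℝ} (hw : ∀ i, ContDiff ℝ ∞ (w i))
    (hI : ∀ m, Integrable (fun x => ∑ i, dnormSq m (w i) x) (volume : Measure (EuclideanSpace ℝ (Fin 3))))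
    {M k : ℕ} (hkM : k + 2 ≤ M) (j : Fin 3) (x : EuclideanSpace ℝ (Fin 3)) :
    dnorm k (w j) x ≤ 3 ^ (k + 1) * K *
      Real.sqrt (∑ m ∈ Finset.range (M + 1), ∫ y, ∑ i, dnormSq m (w i) y) := by
  set Y : ℝ := ∑ m ∈ Finset.range (M + 1), ∫ y, ∑ i, dnormSq m (w i) y with hY
  refine (constantin_dnorm_le_sobolev_levels hK0 hK hw hI k j x).trans ?_
  have hl : ∀ l ∈ Finset.range 3, Real.sqrt (∫ y, ∑ i, dnormSq (l + k) (w i) y) ≤ Real.sqrt Y := by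
    intro l hl
    have hl2 : l ≤ 2 := Nat.lt_succ_iff.1 (Finset.mem_range.1 hl)
    exact Real.sqrt_le_sqrt (constantin_level_le_sum_levels (by omega))
  calc 3 ^ k * K * ∑ l ∈ Finset.range 3, Real.sqrt (∫ y, ∑ i, dnormSq (l + k) (w i) y)
      ≤ 3 ^ k * K * ∑ _l ∈ Finset.range 3, Real.sqrt Y :=
        mul_le_mul_of_nonneg_left (Finset.sum_le_sum hl) (by positivity)
    _ = 3 ^ (k + 1) * K * Real.sqrt Y := by
        rw [Finset.sum_const, Finset.card_range, nsmul_eq_mul, pow_succ]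
        push_cast
        ring

/-- **The trilinear terms close in `Y_M` for `M ≥ 4`**: for `1 ≤ k ≤ n ≤ M`, `0 ≤ χ ≤ 1`,
`∫ χ |∇ᵏwⱼ| |∇^{n-k+1}wᵢ| |∂^α wᵢ| ≤ 3^{M+1} K Y_M^{3/2}` (the factor with at most `M − 2`
derivatives is taken in the sup norm by the Sobolev imbedding, the other two in `L²`; this is
where `m ≥ 3`, here `M = m + 1 ≥ 4`, enters: Constantin 1986, (1.8), `m ≥ 3`). [cite: Constantin1986, §1 (1.8)] -/
theorem constantin_trilinear_le {K : ℝ} (hK0 : 0 ≤ K)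
    (hK : ∀ f : EuclideanSpace ℝ (Fin 3) → ℝ, ContDiff ℝ ∞ f →
      (∀ j ∈ Finset.range 3, Integrable (dnormSq j f) (volume : Measure (EuclideanSpace ℝ (Fin 3)))) →
      ∀ x, |f x| ≤ K * ∑ j ∈ Finset.range 3, Real.sqrt (∫ y, dnormSq j f y))
    {w : Fin 3 → EuclideanSpace ℝ (Fin 3) → ℝ} (hw : ∀ i, ContDiff ℝ ∞ (w i))
    (hI : ∀ m, Integrable (fun x => ∑ i, dnormSq m (w i) x) (volume : Measure (EuclideanSpace ℝ (Fin 3))))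
    {χ : EuclideanSpace ℝ (Fin 3) → ℝ} (hχ0 : ∀ x, 0 ≤ χ x) (hχ1 : ∀ x, χ x ≤ 1)
    {M n k : ℕ} (hM : 4 ≤ M) (hnM : n ≤ M) (hk1 : 1 ≤ k) (hkn : k ≤ n) (α : Fin n → Fin 3) (i j : Fin 3) :
    ∫ x, χ x * (dnorm k (w j) x * (dnorm (n - k + 1) (w i) x * |ipderiv α (w i) x|)) ≤
      3 ^ (M + 1) * K * Real.sqrt (∑ m ∈ Finset.range (M + 1), ∫ y, ∑ i, dnormSq m (w i) y) ^ 3 := by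
  set Y : ℝ := ∑ m ∈ Finset.range (M + 1), ∫ y, ∑ i, dnormSq m (w i) y with hY
  have hY0 : 0 ≤ Real.sqrt Y := Real.sqrt_nonneg _
  obtain ⟨mk, lek⟩ := constantin_memLp_dnorm_and_le hw k (hI k) j
  obtain ⟨mm, lem⟩ := constantin_memLp_dnorm_and_le hw (n - k + 1) (hI (n - k + 1)) i
  obtain ⟨mG, leG⟩ := constantin_memLp_ipderiv_and_le hw (hI n) α i
  have lek' : Real.sqrt (∫ x, dnorm k (w j) x ^ 2) ≤ Real.sqrt Y :=
    lek.trans (Real.sqrt_le_sqrt (constantin_level_le_sum_levels (by omega)))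
  have lem' : Real.sqrt (∫ x, dnorm (n - k + 1) (w i) x ^ 2) ≤ Real.sqrt Y :=
    lem.trans (Real.sqrt_le_sqrt (constantin_level_le_sum_levels (by omega)))
  have leG' : Real.sqrt (∫ x, ipderiv α (w i) x ^ 2) ≤ Real.sqrt Y :=
    leG.trans (Real.sqrt_le_sqrt (constantin_level_le_sum_levels hnM))
  have h3 : ∀ {e : ℕ}, e ≤ M + 1 → (3 : ℝ) ^ e * K * Real.sqrt Y ≤ 3 ^ (M + 1) * K * Real.sqrt Y := fun he =>
    mul_le_mul_of_nonneg_right (mul_le_mul_of_nonneg_right (pow_le_pow_right₀ (by norm_num) he) hK0) hY0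
  by_cases hkM : k + 2 ≤ M
  · -- sup on `|∇ᵏwⱼ|`
    have hsup : ∀ x, |dnorm k (w j) x| ≤ 3 ^ (M + 1) * K * Real.sqrt Y := fun x => by
      rw [abs_of_nonneg (dnorm_nonneg _ _ _)]
      exact (constantin_dnorm_le_sobolev_total hK0 hK hw hI hkM j x).trans (h3 (by omega))
    have hle : ∀ x, |χ x * (dnorm k (w j) x * (dnorm (n - k + 1) (w i) x * |ipderiv α (w i) x|))| ≤
        1 * (|dnorm k (w j) x| * (|dnorm (n - k + 1) (w i) x| * |ipderiv α (w i) x|)) := by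
      intro x
      rw [abs_mul, abs_mul, abs_mul, abs_abs, abs_of_nonneg (hχ0 x), one_mul]
      exact mul_le_of_le_one_left (by positivity) (hχ1 x)
    refine (integral_le_of_abs_le_mul_mul mm mG zero_le_one (by positivity) hsup hle).trans ?_
    rw [one_mul]
    calc 3 ^ (M + 1) * K * Real.sqrt Y * (Real.sqrt (∫ x, dnorm (n - k + 1) (w i) x ^ 2) *
          Real.sqrt (∫ x, ipderiv α (w i) x ^ 2))
        ≤ 3 ^ (M + 1) * K * Real.sqrt Y * (Real.sqrt Y * Real.sqrt Y) := by
          refine mul_le_mul_of_nonneg_left (mul_le_mul lem' leG' (Real.sqrt_nonneg _) hY0) (by positivity)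
      _ = 3 ^ (M + 1) * K * Real.sqrt Y ^ 3 := by ring
  · -- sup on `|∇^{n-k+1}wᵢ|` (`n - k + 1 ≤ 2 ≤ M - 2`)
    have hkM' : n - k + 1 + 2 ≤ M := by omega
    have hsup : ∀ x, |dnorm (n - k + 1) (w i) x| ≤ 3 ^ (M + 1) * K * Real.sqrt Y := fun x => by
      rw [abs_of_nonneg (dnorm_nonneg _ _ _)]
      exact (constantin_dnorm_le_sobolev_total hK0 hK hw hI hkM' i x).trans (h3 (by omega))
    have hle : ∀ x, |χ x * (dnorm k (w j) x * (dnorm (n - k + 1) (w i) x * |ipderiv α (w i) x|))| ≤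
        1 * (|dnorm (n - k + 1) (w i) x| * (|dnorm k (w j) x| * |ipderiv α (w i) x|)) := by
      intro x
      rw [abs_mul, abs_mul, abs_mul, abs_abs, abs_of_nonneg (hχ0 x), one_mul]
      calc χ x * (|dnorm k (w j) x| * (|dnorm (n - k + 1) (w i) x| * |ipderiv α (w i) x|))
          ≤ 1 * (|dnorm k (w j) x| * (|dnorm (n - k + 1) (w i) x| * |ipderiv α (w i) x|)) :=
            mul_le_of_le_one_left (by positivity) (hχ1 x) |>.trans (le_of_eq (one_mul _).symm)
        _ = _ := by ring
    refine (integral_le_of_abs_le_mul_mul mk mG zero_le_one (by positivity) hsup hle).trans ?_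
    rw [one_mul]
    calc 3 ^ (M + 1) * K * Real.sqrt Y * (Real.sqrt (∫ x, dnorm k (w j) x ^ 2) *
          Real.sqrt (∫ x, ipderiv α (w i) x ^ 2))
        ≤ 3 ^ (M + 1) * K * Real.sqrt Y * (Real.sqrt Y * Real.sqrt Y) := by
          refine mul_le_mul_of_nonneg_left (mul_le_mul lek' leG' (Real.sqrt_nonneg _) hY0) (by positivity)
      _ = 3 ^ (M + 1) * K * Real.sqrt Y ^ 3 := by ring

end Closure

/-! ## The closed slice inequality in dimension three -/

section ClosedSlice

/-- **The pressure error weight in terms of level integrals**: with `Gᵢ = ∂^α wᵢ`, `|α| = n`,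
`∫ (∑ᵢ ∑_{k≤n} |∇^{n-k}Gᵢ|)² ≤ 9 (n+1) ∑_{k≤n} ∫ ∑ᵢ |∇^{2n-k} wᵢ|²` (Cauchy–Schwarz on the
finite sum, `|∇ˡ∂^α wᵢ|² ≤ |∇^{l+n}wᵢ|²`). [folklore] -/
theorem constantin_integral_pressureWeight_sq_le {w : Fin 3 → EuclideanSpace ℝ (Fin 3) → ℝ} (hw : ∀ i, ContDiff ℝ ∞ (w i))
    (hI : ∀ m, Integrable (fun x => ∑ i, dnormSq m (w i) x) (volume : Measure (EuclideanSpace ℝ (Fin 3))))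
    {n : ℕ} (α : Fin n → Fin 3) :
    ∫ x, (∑ i, ∑ k ∈ Finset.range (n + 1), dnorm (n - k) (ipderiv α (w i)) x) ^ 2 ≤
      9 * (n + 1) * ∑ k ∈ Finset.range (n + 1), ∫ x, ∑ i, dnormSq (n - k + n) (w i) x := by
  have hG : ∀ i, ContDiff ℝ ∞ (ipderiv α (w i)) := fun i => contDiff_ipderiv (hw i) α
  -- pointwise Cauchy–Schwarz on the finite sum
  have hpt : ∀ x, (∑ i, ∑ k ∈ Finset.range (n + 1), dnorm (n - k) (ipderiv α (w i)) x) ^ 2 ≤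
      9 * (n + 1) * ∑ k ∈ Finset.range (n + 1), ∑ i, dnormSq (n - k + n) (w i) x := by
    intro x
    have h1 : (∑ i, ∑ k ∈ Finset.range (n + 1), dnorm (n - k) (ipderiv α (w i)) x) ^ 2 ≤
        ((Finset.univ : Finset (Fin 3)) ×ˢ Finset.range (n + 1)).card *
          ∑ ik ∈ (Finset.univ : Finset (Fin 3)) ×ˢ Finset.range (n + 1),
            dnorm (n - ik.2) (ipderiv α (w ik.1)) x ^ 2 := by
      rw [← Finset.sum_product (s := (Finset.univ : Finset (Fin 3))) (t := Finset.range (n + 1))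
        (f := fun ik => dnorm (n - ik.2) (ipderiv α (w ik.1)) x)]
      exact sq_sum_le_card_mul_sum_sq
    refine h1.trans ?_
    rw [Finset.card_product, Finset.card_univ, Fintype.card_fin, Finset.card_range, Finset.sum_product]
    push_cast
    have h2 : ∀ i, ∀ k ∈ Finset.range (n + 1), dnorm (n - k) (ipderiv α (w i)) x ^ 2 ≤
        ∑ i', dnormSq (n - k + n) (w i') x := by
      intro i k _
      rw [dnorm_sq]
      exact (dnormSq_ipderiv_le (hw i) (n - k) α x).trans
        (Finset.single_le_sum (f := fun i' => dnormSq (n - k + n) (w i') x) (fun _ _ => dnormSq_nonneg _ _ _)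
          (Finset.mem_univ i))
    calc (3 : ℝ) * (n + 1) * ∑ i, ∑ k ∈ Finset.range (n + 1), dnorm (n - k) (ipderiv α (w i)) x ^ 2
        ≤ 3 * (n + 1) * ∑ _i : Fin 3, ∑ k ∈ Finset.range (n + 1), ∑ i', dnormSq (n - k + n) (w i') x := by
          gcongr with i _ k hk
          exact h2 i k hk
      _ = 9 * (n + 1) * ∑ k ∈ Finset.range (n + 1), ∑ i, dnormSq (n - k + n) (w i) x := by
          rw [Finset.sum_const, Finset.card_univ, Fintype.card_fin, nsmul_eq_mul]
          push_cast
          ring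
  -- integrability of both sides
  have hZmem : MemLp (fun x => ∑ i, ∑ k ∈ Finset.range (n + 1), dnorm (n - k) (ipderiv α (w i)) x) 2
      (volume : Measure (EuclideanSpace ℝ (Fin 3))) := by
    refine memLp_finsetSum _ fun i _ => memLp_finsetSum _ fun k hk => ?_
    have hIi : Integrable (dnormSq (n - k + n) (w i)) := (constantin_integrable_dnormSq_of_sum hw (n - k + n) (hI _) i).1
    exact (memLp_dnorm_of_integrable_dnormSq (hG i) (n - k) (integrable_dnormSq_ipderiv (hw i) (n - k) α hIi)).1
  have hZ2 : Integrable (fun x => (∑ i, ∑ k ∈ Finset.range (n + 1), dnorm (n - k) (ipderiv α (w i)) x) ^ 2)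
      (volume : Measure (EuclideanSpace ℝ (Fin 3))) :=
    (memLp_two_iff_integrable_sq hZmem.1).1 hZmem
  have hR : Integrable (fun x => 9 * (n + 1) * ∑ k ∈ Finset.range (n + 1), ∑ i, dnormSq (n - k + n) (w i) x)
      (volume : Measure (EuclideanSpace ℝ (Fin 3))) :=
    (integrable_finsetSum _ fun k _ => hI (n - k + n)).const_mul _
  refine (integral_mono hZ2 hR hpt).trans (le_of_eq ?_)
  rw [integral_const_mul, integral_finsetSum _ fun k _ => hI (n - k + n)]

/-- **The closed slice inequality for a fixed word** (dimension three, `1 ≤ n ≤ M`, `M ≥ 4`… in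
fact any `n ≤ M` with `M ≥ 4`): the bound of `constantin_slice_word_pairing_le` with the level integrals of
`w` replaced by the total `Y_M = ∑_{m≤M} ∫∑ᵢ|∇ᵐwᵢ|²` and the trilinear terms closed by the
Sobolev imbedding (`constantin_trilinear_le`):
`∑ᵢ ∫ χ Ẇ_{α,i} G_{α,i} ≤ A_R E_n + 9ν ‖∇ⁿ⁺²b‖₂ √Y + 9·2ⁿ B_b (n+1)² Y + 9n·2ⁿ 3^{M+1} K (√Y)³`
— Constantin 1986, (1.10): `d/dt ‖w‖_m ≤ ν‖Δv‖_m + c‖w‖²_m + c‖v‖_{m+1}‖w‖_m`, localised. [cite: Constantin1986, §1 (1.10)] -/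
theorem constantin_slice_word_pairing_closed_le {K : ℝ} (hK0 : 0 ≤ K)
    (hK : ∀ f : EuclideanSpace ℝ (Fin 3) → ℝ, ContDiff ℝ ∞ f →
      (∀ j ∈ Finset.range 3, Integrable (dnormSq j f) (volume : Measure (EuclideanSpace ℝ (Fin 3)))) →
      ∀ x, |f x| ≤ K * ∑ j ∈ Finset.range 3, Real.sqrt (∫ y, dnormSq j f y))
    {a b : EuclideanSpace ℝ (Fin 3) → EuclideanSpace ℝ (Fin 3)}
    {p₁ p₂ Q χ : EuclideanSpace ℝ (Fin 3) → ℝ} {c₀ : ℝ}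
    (ha : ContDiff ℝ ∞ a) (hb : ContDiff ℝ ∞ b)
    (hdiva : ∀ x, ∑ j, pderiv j (fun y => a y j) x = 0) (hdivb : ∀ x, ∑ j, pderiv j (fun y => b y j) x = 0)
    (hp₁ : ContDiff ℝ ∞ p₁) (hp₂ : ContDiff ℝ ∞ p₂) (hrQ : ∀ x, p₁ x - p₂ x = Q x + c₀)
    (hQ : MemLp Q 2 (volume : Measure (EuclideanSpace ℝ (Fin 3))))
    (hχ : ContDiff ℝ ∞ χ) (hχc : HasCompactSupport χ) (hχ0 : ∀ x, 0 ≤ χ x) (hχ1 : ∀ x, χ x ≤ 1)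
    {M n : ℕ} (hM : 4 ≤ M) (hnM : n ≤ M) (α : Fin n → Fin 3)
    (hI : ∀ k, Integrable (fun x => ∑ i, dnormSq k (fun z => a z i - b z i) x)
      (volume : Measure (EuclideanSpace ℝ (Fin 3))))
    (hIb : Integrable (fun x => ∑ i, dnormSq (n + 2) (fun y => b y i) x) (volume : Measure (EuclideanSpace ℝ (Fin 3))))
    {ν Ba Bb AR : ℝ} (hν : 0 ≤ ν) (hBa0 : 0 ≤ Ba) (hBa : ∀ x j, |a x j| ≤ Ba) (hBb0 : 0 ≤ Bb)
    (hBb : ∀ k, k ≤ n + 1 → ∀ i x, dnorm k (fun y => b y i) x ≤ Bb) (hAR0 : 0 ≤ AR)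
    (hAR1 : ∀ j x, |pderiv j χ x| ≤ AR) (hAR : ∀ k, 1 ≤ k → k ≤ n + 1 → ∀ x, dnorm k χ x ≤ AR) :
    ∑ i, ∫ x, χ x *
      ((ipderiv α (fun y => ν * ∑ j, pderiv j (pderiv j fun z => a z i) y - pderiv i p₁ y -
            ∑ j, a y j * pderiv j (fun z => a z i) y) x -
          ipderiv α (fun y => 0 * ∑ j, pderiv j (pderiv j fun z => b z i) y - pderiv i p₂ y -
            ∑ j, b y j * pderiv j (fun z => b z i) y) x) *
        ipderiv α (fun z => a z i - b z i) x) ≤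
      AR * (2⁻¹ * 9 * Ba * (∫ x, ∑ i, dnormSq n (fun z => a z i - b z i) x) +
          ν * 9 * Real.sqrt (∫ x, ∑ i, dnormSq n (fun z => a z i - b z i) x) *
            Real.sqrt (∫ x, ∑ i, dnormSq (n + 1) (fun z => a z i - b z i) x) +
          2 ^ n * Real.sqrt (∫ x, Q x ^ 2) *
            Real.sqrt (9 * (n + 1) * ∑ k ∈ Finset.range (n + 1),
              ∫ x, ∑ i, dnormSq (n - k + n) (fun z => a z i - b z i) x)) +
      ν * 9 * Real.sqrt (∫ x, ∑ i, dnormSq (n + 2) (fun y => b y i) x) *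
        Real.sqrt (∑ m ∈ Finset.range (M + 1), ∫ x, ∑ i, dnormSq m (fun z => a z i - b z i) x) +
      2 ^ n * 9 * Bb * (n + 1) ^ 2 *
        (∑ m ∈ Finset.range (M + 1), ∫ x, ∑ i, dnormSq m (fun z => a z i - b z i) x) +
      2 ^ n * 9 * n * (3 ^ (M + 1) * K) *
        Real.sqrt (∑ m ∈ Finset.range (M + 1), ∫ x, ∑ i, dnormSq m (fun z => a z i - b z i) x) ^ 3 := by
  have hA : ∀ j, ContDiff ℝ ∞ fun y => a y j := fun j => contDiff_comp_of_contDiff ha j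
  have hB : ∀ j, ContDiff ℝ ∞ fun y => b y j := fun j => contDiff_comp_of_contDiff hb j
  have hw : ∀ i, ContDiff ℝ ∞ ((fun i z => a z i - b z i) i) := fun i => (hA i).sub (hB i)
  have hL0 : ∀ k, 0 ≤ (∫ x, ∑ i, dnormSq k (fun z => a z i - b z i) x) := fun k =>
    integral_nonneg fun _ => Finset.sum_nonneg fun _ _ => dnormSq_nonneg _ _ _
  have hY0 : 0 ≤ (∑ m ∈ Finset.range (M + 1), ∫ x, ∑ i, dnormSq m (fun z => a z i - b z i) x) := Finset.sum_nonneg fun k _ => hL0 k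
  have hsY0 : 0 ≤ Real.sqrt (∑ m ∈ Finset.range (M + 1), ∫ x, ∑ i, dnormSq m (fun z => a z i - b z i) x) := Real.sqrt_nonneg _
  have hbase := constantin_slice_word_pairing_le ha hb hdiva hdivb hp₁ hp₂ hrQ hQ hχ hχc hχ0 hχ1 α hI hIb hν hBa0 hBa
    hBb0 hBb hAR0 hAR1 hAR
  simp only [Fintype.card_fin] at hbase
  push_cast at hbase
  -- `√L n ≤ √Y`, `S ≤ (n+1) √Y`
  have hLY : ∀ {m}, m ≤ M → Real.sqrt (∫ x, ∑ i, dnormSq m (fun z => a z i - b z i) x) ≤ Real.sqrt (∑ m ∈ Finset.range (M + 1), ∫ x, ∑ i, dnormSq m (fun z => a z i - b z i) x) := fun hm =>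
    Real.sqrt_le_sqrt (constantin_level_le_sum_levels hm)
  have hLnY : Real.sqrt (∫ x, ∑ i, dnormSq n (fun z => a z i - b z i) x) ≤ Real.sqrt (∑ m ∈ Finset.range (M + 1), ∫ x, ∑ i, dnormSq m (fun z => a z i - b z i) x) := hLY hnM
  have hS : ∑ k ∈ Finset.range (n + 1), Real.sqrt (∫ x, ∑ i, dnormSq k (fun z => a z i - b z i) x) ≤ (n + 1) * Real.sqrt (∑ m ∈ Finset.range (M + 1), ∫ x, ∑ i, dnormSq m (fun z => a z i - b z i) x) := by
    calc ∑ k ∈ Finset.range (n + 1), Real.sqrt (∫ x, ∑ i, dnormSq k (fun z => a z i - b z i) x) ≤ ∑ _k ∈ Finset.range (n + 1), Real.sqrt (∑ m ∈ Finset.range (M + 1), ∫ x, ∑ i, dnormSq m (fun z => a z i - b z i) x) :=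
          Finset.sum_le_sum fun k hk => hLY (by have := Finset.mem_range.1 hk; omega)
      _ = (n + 1) * Real.sqrt (∑ m ∈ Finset.range (M + 1), ∫ x, ∑ i, dnormSq m (fun z => a z i - b z i) x) := by
          rw [Finset.sum_const, Finset.card_range, nsmul_eq_mul]; push_cast; ring
  have hS0 : 0 ≤ ∑ k ∈ Finset.range (n + 1), Real.sqrt (∫ x, ∑ i, dnormSq k (fun z => a z i - b z i) x) :=
    Finset.sum_nonneg fun _ _ => Real.sqrt_nonneg _
  -- the pressure weight
  have hZ := constantin_integral_pressureWeight_sq_le hw hI α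
  -- the trilinear terms
  have htri : ∑ i, ∑ j, ∑ k ∈ Finset.Icc 1 n,
      ∫ x, χ x * (dnorm k ((fun i z => a z i - b z i) j) x * (dnorm (n - k + 1) ((fun i z => a z i - b z i) i) x * |ipderiv α ((fun i z => a z i - b z i) i) x|)) ≤
      9 * n * (3 ^ (M + 1) * K * Real.sqrt (∑ m ∈ Finset.range (M + 1), ∫ x, ∑ i, dnormSq m (fun z => a z i - b z i) x) ^ 3) := by
    calc ∑ i, ∑ j, ∑ k ∈ Finset.Icc 1 n,
          ∫ x, χ x * (dnorm k ((fun i z => a z i - b z i) j) x * (dnorm (n - k + 1) ((fun i z => a z i - b z i) i) x * |ipderiv α ((fun i z => a z i - b z i) i) x|))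
        ≤ ∑ _i : Fin 3, ∑ _j : Fin 3, ∑ _k ∈ Finset.Icc 1 n, 3 ^ (M + 1) * K * Real.sqrt (∑ m ∈ Finset.range (M + 1), ∫ x, ∑ i, dnormSq m (fun z => a z i - b z i) x) ^ 3 := by
          refine Finset.sum_le_sum fun i _ => Finset.sum_le_sum fun j _ => Finset.sum_le_sum fun k hk => ?_
          have hk' := Finset.mem_Icc.1 hk
          exact constantin_trilinear_le hK0 hK hw hI hχ0 hχ1 hM hnM hk'.1 hk'.2 α i j
      _ = 9 * n * (3 ^ (M + 1) * K * Real.sqrt (∑ m ∈ Finset.range (M + 1), ∫ x, ∑ i, dnormSq m (fun z => a z i - b z i) x) ^ 3) := by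
          rw [Finset.sum_const, Finset.sum_const, Finset.sum_const, Finset.card_univ, Fintype.card_fin,
            Nat.card_Icc, nsmul_eq_mul, nsmul_eq_mul, nsmul_eq_mul]
          push_cast
          ring
  simp only at htri
  -- products of square roots
  have hsq : Real.sqrt (∑ m ∈ Finset.range (M + 1), ∫ x, ∑ i, dnormSq m (fun z => a z i - b z i) x) * Real.sqrt (∑ m ∈ Finset.range (M + 1), ∫ x, ∑ i, dnormSq m (fun z => a z i - b z i) x) = (∑ m ∈ Finset.range (M + 1), ∫ x, ∑ i, dnormSq m (fun z => a z i - b z i) x) := Real.mul_self_sqrt hY0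
  have hp2 : (∑ k ∈ Finset.range (n + 1), Real.sqrt (∫ x, ∑ i, dnormSq k (fun z => a z i - b z i) x)) * Real.sqrt (∫ x, ∑ i, dnormSq n (fun z => a z i - b z i) x) ≤ (n + 1) * (∑ m ∈ Finset.range (M + 1), ∫ x, ∑ i, dnormSq m (fun z => a z i - b z i) x) := by
    calc (∑ k ∈ Finset.range (n + 1), Real.sqrt (∫ x, ∑ i, dnormSq k (fun z => a z i - b z i) x)) * Real.sqrt (∫ x, ∑ i, dnormSq n (fun z => a z i - b z i) x)
        ≤ ((n + 1) * Real.sqrt (∑ m ∈ Finset.range (M + 1), ∫ x, ∑ i, dnormSq m (fun z => a z i - b z i) x)) * Real.sqrt (∑ m ∈ Finset.range (M + 1), ∫ x, ∑ i, dnormSq m (fun z => a z i - b z i) x) := mul_le_mul hS hLnY (Real.sqrt_nonneg _) (by positivity)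
      _ = (n + 1) * (∑ m ∈ Finset.range (M + 1), ∫ x, ∑ i, dnormSq m (fun z => a z i - b z i) x) := by rw [mul_assoc, hsq]
  have hp3 := Real.sqrt_le_sqrt hZ
  have hQ0 : 0 ≤ Real.sqrt (∫ x, Q x ^ 2) := Real.sqrt_nonneg _
  have h2n : (0 : ℝ) ≤ 2 ^ n := by positivity
  -- the four scaled comparisons
  have i1 : AR * (2 ^ n * Real.sqrt (∫ x, Q x ^ 2) *
      Real.sqrt (∫ x, (∑ i, ∑ k ∈ Finset.range (n + 1), dnorm (n - k) (ipderiv α ((fun i z => a z i - b z i) i)) x) ^ 2)) ≤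
      AR * (2 ^ n * Real.sqrt (∫ x, Q x ^ 2) *
        Real.sqrt (9 * (n + 1) * ∑ k ∈ Finset.range (n + 1), (∫ x, ∑ i, dnormSq (n - k + n) (fun z => a z i - b z i) x))) :=
    mul_le_mul_of_nonneg_left (mul_le_mul_of_nonneg_left hp3 (mul_nonneg h2n hQ0)) hAR0
  have i2 : ν * 9 * Real.sqrt (∫ x, ∑ i, dnormSq (n + 2) (fun y => b y i) x) * Real.sqrt (∫ x, ∑ i, dnormSq n (fun z => a z i - b z i) x) ≤
      ν * 9 * Real.sqrt (∫ x, ∑ i, dnormSq (n + 2) (fun y => b y i) x) * Real.sqrt (∑ m ∈ Finset.range (M + 1), ∫ x, ∑ i, dnormSq m (fun z => a z i - b z i) x) :=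
    mul_le_mul_of_nonneg_left hLnY (by positivity)
  have i3 : 2 ^ n * 9 * Bb * (n + 1) * (∑ k ∈ Finset.range (n + 1), Real.sqrt (∫ x, ∑ i, dnormSq k (fun z => a z i - b z i) x)) * Real.sqrt (∫ x, ∑ i, dnormSq n (fun z => a z i - b z i) x) ≤
      2 ^ n * 9 * Bb * (n + 1) ^ 2 * (∑ m ∈ Finset.range (M + 1), ∫ x, ∑ i, dnormSq m (fun z => a z i - b z i) x) := by
    have := mul_le_mul_of_nonneg_left hp2 (by positivity : (0 : ℝ) ≤ 2 ^ n * 9 * Bb * (n + 1))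
    calc 2 ^ n * 9 * Bb * (n + 1) * (∑ k ∈ Finset.range (n + 1), Real.sqrt (∫ x, ∑ i, dnormSq k (fun z => a z i - b z i) x)) * Real.sqrt (∫ x, ∑ i, dnormSq n (fun z => a z i - b z i) x)
        = 2 ^ n * 9 * Bb * (n + 1) * ((∑ k ∈ Finset.range (n + 1), Real.sqrt (∫ x, ∑ i, dnormSq k (fun z => a z i - b z i) x)) * Real.sqrt (∫ x, ∑ i, dnormSq n (fun z => a z i - b z i) x)) := by
          ring
      _ ≤ 2 ^ n * 9 * Bb * (n + 1) * ((n + 1) * (∑ m ∈ Finset.range (M + 1), ∫ x, ∑ i, dnormSq m (fun z => a z i - b z i) x)) := this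
      _ = 2 ^ n * 9 * Bb * (n + 1) ^ 2 * (∑ m ∈ Finset.range (M + 1), ∫ x, ∑ i, dnormSq m (fun z => a z i - b z i) x) := by ring
  have i4 := mul_le_mul_of_nonneg_left htri h2n
  simp only at i1 i4
  linarith [hbase, i1, i2, i3, i4]

end ClosedSlice

/-! ## The total slice inequality: sum over words and levels -/

section Total

/-- **The total slice inequality** (dimension three, `M ≥ 4`): summing the closed fixed-word
inequality over all words `α` of length `n` (`3ⁿ` of them) and all levels `n ≤ M` gives, for
`Y = Y_M = ∑_{m ≤ M} ∫∑ᵢ|∇ᵐwᵢ|²`,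
`∑_{n ≤ M} ∑_α ∑ᵢ ∫ χ Ẇ_{α,i} G_{α,i} ≤ A_R E + ν A √Y + B Y + K' (√Y)³`
with `E` an explicit combination of level integrals of `w` and `‖Q‖₂` (the cutoff errors),
`A = 9(M+1)3^M √I_b` (`I_b` bounding `∫∑ᵢ|∇ᵐbᵢ|²`, `m ≤ M + 2`), `B = 9(M+1)³6^M B_b`,
`K' = 9M(M+1)6^M 3^(M+1) K` — constants depending only on `M`, the sup and `L²` bounds of the
derivatives of `b`, and the Sobolev constant `K`. This is Constantin's (1.10),
`d/dt‖w‖_m ≤ ν‖Δv‖_m + c‖w‖²_m + c‖v‖_{m+1}‖w‖_m`, localised and before time integration. [cite: Constantin1986, §1 (1.10)] -/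
theorem constantin_slice_total_pairing_le {K : ℝ} (hK0 : 0 ≤ K)
    (hK : ∀ f : EuclideanSpace ℝ (Fin 3) → ℝ, ContDiff ℝ ∞ f →
      (∀ j ∈ Finset.range 3, Integrable (dnormSq j f) (volume : Measure (EuclideanSpace ℝ (Fin 3)))) →
      ∀ x, |f x| ≤ K * ∑ j ∈ Finset.range 3, Real.sqrt (∫ y, dnormSq j f y))
    {a b : EuclideanSpace ℝ (Fin 3) → EuclideanSpace ℝ (Fin 3)}
    {p₁ p₂ Q χ : EuclideanSpace ℝ (Fin 3) → ℝ} {c₀ : ℝ}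
    (ha : ContDiff ℝ ∞ a) (hb : ContDiff ℝ ∞ b)
    (hdiva : ∀ x, ∑ j, pderiv j (fun y => a y j) x = 0) (hdivb : ∀ x, ∑ j, pderiv j (fun y => b y j) x = 0)
    (hp₁ : ContDiff ℝ ∞ p₁) (hp₂ : ContDiff ℝ ∞ p₂) (hrQ : ∀ x, p₁ x - p₂ x = Q x + c₀)
    (hQ : MemLp Q 2 (volume : Measure (EuclideanSpace ℝ (Fin 3))))
    (hχ : ContDiff ℝ ∞ χ) (hχc : HasCompactSupport χ) (hχ0 : ∀ x, 0 ≤ χ x) (hχ1 : ∀ x, χ x ≤ 1)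
    {M : ℕ} (hM : 4 ≤ M)
    (hI : ∀ k, Integrable (fun x => ∑ i, dnormSq k (fun z => a z i - b z i) x)
      (volume : Measure (EuclideanSpace ℝ (Fin 3))))
    (hIb : ∀ k, Integrable (fun x => ∑ i, dnormSq k (fun y => b y i) x) (volume : Measure (EuclideanSpace ℝ (Fin 3))))
    {ν Ba Bb IB AR : ℝ} (hν : 0 ≤ ν) (hBa0 : 0 ≤ Ba) (hBa : ∀ x j, |a x j| ≤ Ba) (hBb0 : 0 ≤ Bb)
    (hBb : ∀ k, k ≤ M + 1 → ∀ i x, dnorm k (fun y => b y i) x ≤ Bb)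
    (hIB : ∀ k, k ≤ M + 2 → (∫ x, ∑ i, dnormSq k (fun y => b y i) x) ≤ IB) (hAR0 : 0 ≤ AR)
    (hAR1 : ∀ j x, |pderiv j χ x| ≤ AR) (hAR : ∀ k, 1 ≤ k → k ≤ M + 1 → ∀ x, dnorm k χ x ≤ AR) :
    ∑ n ∈ Finset.range (M + 1), ∑ α : Fin n → Fin 3, ∑ i, ∫ x, χ x *
        ((ipderiv α (fun y => ν * ∑ j, pderiv j (pderiv j fun z => a z i) y - pderiv i p₁ y -
              ∑ j, a y j * pderiv j (fun z => a z i) y) x -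
            ipderiv α (fun y => 0 * ∑ j, pderiv j (pderiv j fun z => b z i) y - pderiv i p₂ y -
              ∑ j, b y j * pderiv j (fun z => b z i) y) x) *
          ipderiv α (fun z => a z i - b z i) x) ≤
      AR * ∑ n ∈ Finset.range (M + 1), 3 ^ n *
        (2⁻¹ * 9 * Ba * (∫ x, ∑ i, dnormSq n (fun z => a z i - b z i) x) +
          ν * 9 * Real.sqrt (∫ x, ∑ i, dnormSq n (fun z => a z i - b z i) x) * Real.sqrt (∫ x, ∑ i, dnormSq (n + 1) (fun z => a z i - b z i) x) +
          2 ^ n * Real.sqrt (∫ x, Q x ^ 2) *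
            Real.sqrt (9 * (n + 1) * ∑ k ∈ Finset.range (n + 1), (∫ x, ∑ i, dnormSq (n - k + n) (fun z => a z i - b z i) x))) +
      ν * (9 * (M + 1) * 3 ^ M * Real.sqrt IB) * Real.sqrt (∑ m ∈ Finset.range (M + 1), ∫ x, ∑ i, dnormSq m (fun z => a z i - b z i) x) +
      9 * (M + 1) ^ 3 * 6 ^ M * Bb * (∑ m ∈ Finset.range (M + 1), ∫ x, ∑ i, dnormSq m (fun z => a z i - b z i) x) +
      9 * M * (M + 1) * 6 ^ M * 3 ^ (M + 1) * K * Real.sqrt (∑ m ∈ Finset.range (M + 1), ∫ x, ∑ i, dnormSq m (fun z => a z i - b z i) x) ^ 3 := by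
  have hY0 : 0 ≤ (∑ m ∈ Finset.range (M + 1), ∫ x, ∑ i, dnormSq m (fun z => a z i - b z i) x) :=
    Finset.sum_nonneg fun k _ => integral_nonneg fun _ => Finset.sum_nonneg fun _ _ => dnormSq_nonneg _ _ _
  have hsY0 : 0 ≤ Real.sqrt (∑ m ∈ Finset.range (M + 1), ∫ x, ∑ i, dnormSq m (fun z => a z i - b z i) x) := Real.sqrt_nonneg _
  have hIB0 : 0 ≤ IB := le_trans (integral_nonneg fun _ => Finset.sum_nonneg fun _ _ => dnormSq_nonneg _ _ _)
    (hIB 0 (by omega))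
  -- the closed bound for each `(n, α)`, `n ≤ M`
  have hword : ∀ n ∈ Finset.range (M + 1), ∀ α : Fin n → Fin 3, ∑ i, ∫ x, χ x *
        ((ipderiv α (fun y => ν * ∑ j, pderiv j (pderiv j fun z => a z i) y - pderiv i p₁ y -
              ∑ j, a y j * pderiv j (fun z => a z i) y) x -
            ipderiv α (fun y => 0 * ∑ j, pderiv j (pderiv j fun z => b z i) y - pderiv i p₂ y -
              ∑ j, b y j * pderiv j (fun z => b z i) y) x) *
          ipderiv α (fun z => a z i - b z i) x) ≤
      AR * (2⁻¹ * 9 * Ba * (∫ x, ∑ i, dnormSq n (fun z => a z i - b z i) x) +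
          ν * 9 * Real.sqrt (∫ x, ∑ i, dnormSq n (fun z => a z i - b z i) x) * Real.sqrt (∫ x, ∑ i, dnormSq (n + 1) (fun z => a z i - b z i) x) +
          2 ^ n * Real.sqrt (∫ x, Q x ^ 2) *
            Real.sqrt (9 * (n + 1) * ∑ k ∈ Finset.range (n + 1), (∫ x, ∑ i, dnormSq (n - k + n) (fun z => a z i - b z i) x))) +
      ν * 9 * Real.sqrt IB * Real.sqrt (∑ m ∈ Finset.range (M + 1), ∫ x, ∑ i, dnormSq m (fun z => a z i - b z i) x) +
      2 ^ n * 9 * Bb * (n + 1) ^ 2 * (∑ m ∈ Finset.range (M + 1), ∫ x, ∑ i, dnormSq m (fun z => a z i - b z i) x) +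
      2 ^ n * 9 * n * (3 ^ (M + 1) * K) * Real.sqrt (∑ m ∈ Finset.range (M + 1), ∫ x, ∑ i, dnormSq m (fun z => a z i - b z i) x) ^ 3 := by
    intro n hn α
    have hnM : n ≤ M := Nat.lt_succ_iff.1 (Finset.mem_range.1 hn)
    have h := constantin_slice_word_pairing_closed_le hK0 hK ha hb hdiva hdivb hp₁ hp₂ hrQ hQ hχ hχc hχ0 hχ1 hM hnM α hI
      (hIb (n + 2)) hν hBa0 hBa hBb0 (fun k hk => hBb k (by omega)) hAR0 hAR1 (fun k hk1 hk2 => hAR k hk1 (by omega))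
    have hb2 : Real.sqrt (∫ x, ∑ i, dnormSq (n + 2) (fun y => b y i) x) ≤ Real.sqrt IB :=
      Real.sqrt_le_sqrt (hIB (n + 2) (by omega))
    have i2 : ν * 9 * Real.sqrt (∫ x, ∑ i, dnormSq (n + 2) (fun y => b y i) x) * Real.sqrt (∑ m ∈ Finset.range (M + 1), ∫ x, ∑ i, dnormSq m (fun z => a z i - b z i) x) ≤
        ν * 9 * Real.sqrt IB * Real.sqrt (∑ m ∈ Finset.range (M + 1), ∫ x, ∑ i, dnormSq m (fun z => a z i - b z i) x) :=
      mul_le_mul_of_nonneg_right (mul_le_mul_of_nonneg_left hb2 (by positivity)) hsY0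
    linarith
  -- sum over the `3ⁿ` words
  have hlevel : ∀ n ∈ Finset.range (M + 1), ∑ α : Fin n → Fin 3, ∑ i, ∫ x, χ x *
        ((ipderiv α (fun y => ν * ∑ j, pderiv j (pderiv j fun z => a z i) y - pderiv i p₁ y -
              ∑ j, a y j * pderiv j (fun z => a z i) y) x -
            ipderiv α (fun y => 0 * ∑ j, pderiv j (pderiv j fun z => b z i) y - pderiv i p₂ y -
              ∑ j, b y j * pderiv j (fun z => b z i) y) x) *
          ipderiv α (fun z => a z i - b z i) x) ≤
      3 ^ n * (AR * (2⁻¹ * 9 * Ba * (∫ x, ∑ i, dnormSq n (fun z => a z i - b z i) x) +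
          ν * 9 * Real.sqrt (∫ x, ∑ i, dnormSq n (fun z => a z i - b z i) x) * Real.sqrt (∫ x, ∑ i, dnormSq (n + 1) (fun z => a z i - b z i) x) +
          2 ^ n * Real.sqrt (∫ x, Q x ^ 2) *
            Real.sqrt (9 * (n + 1) * ∑ k ∈ Finset.range (n + 1), (∫ x, ∑ i, dnormSq (n - k + n) (fun z => a z i - b z i) x))) +
      ν * 9 * Real.sqrt IB * Real.sqrt (∑ m ∈ Finset.range (M + 1), ∫ x, ∑ i, dnormSq m (fun z => a z i - b z i) x) +
      2 ^ n * 9 * Bb * (n + 1) ^ 2 * (∑ m ∈ Finset.range (M + 1), ∫ x, ∑ i, dnormSq m (fun z => a z i - b z i) x) +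
      2 ^ n * 9 * n * (3 ^ (M + 1) * K) * Real.sqrt (∑ m ∈ Finset.range (M + 1), ∫ x, ∑ i, dnormSq m (fun z => a z i - b z i) x) ^ 3) := by
    intro n hn
    refine (Finset.sum_le_sum fun α _ => hword n hn α).trans (le_of_eq ?_)
    rw [Finset.sum_const, Finset.card_univ, Fintype.card_fun, Fintype.card_fin, Fintype.card_fin, nsmul_eq_mul]
    push_cast
    ring
  refine (Finset.sum_le_sum hlevel).trans ?_
  -- crude bounds of the level-dependent coefficients, `n ≤ M`
  have hcoef : ∀ n ∈ Finset.range (M + 1),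
      3 ^ n * (AR * (2⁻¹ * 9 * Ba * (∫ x, ∑ i, dnormSq n (fun z => a z i - b z i) x) +
          ν * 9 * Real.sqrt (∫ x, ∑ i, dnormSq n (fun z => a z i - b z i) x) * Real.sqrt (∫ x, ∑ i, dnormSq (n + 1) (fun z => a z i - b z i) x) +
          2 ^ n * Real.sqrt (∫ x, Q x ^ 2) *
            Real.sqrt (9 * (n + 1) * ∑ k ∈ Finset.range (n + 1), (∫ x, ∑ i, dnormSq (n - k + n) (fun z => a z i - b z i) x))) +
      ν * 9 * Real.sqrt IB * Real.sqrt (∑ m ∈ Finset.range (M + 1), ∫ x, ∑ i, dnormSq m (fun z => a z i - b z i) x) +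
      2 ^ n * 9 * Bb * (n + 1) ^ 2 * (∑ m ∈ Finset.range (M + 1), ∫ x, ∑ i, dnormSq m (fun z => a z i - b z i) x) +
      2 ^ n * 9 * n * (3 ^ (M + 1) * K) * Real.sqrt (∑ m ∈ Finset.range (M + 1), ∫ x, ∑ i, dnormSq m (fun z => a z i - b z i) x) ^ 3) ≤
      AR * (3 ^ n * (2⁻¹ * 9 * Ba * (∫ x, ∑ i, dnormSq n (fun z => a z i - b z i) x) +
          ν * 9 * Real.sqrt (∫ x, ∑ i, dnormSq n (fun z => a z i - b z i) x) * Real.sqrt (∫ x, ∑ i, dnormSq (n + 1) (fun z => a z i - b z i) x) +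
          2 ^ n * Real.sqrt (∫ x, Q x ^ 2) *
            Real.sqrt (9 * (n + 1) * ∑ k ∈ Finset.range (n + 1), (∫ x, ∑ i, dnormSq (n - k + n) (fun z => a z i - b z i) x)))) +
      ν * (9 * 3 ^ M * Real.sqrt IB) * Real.sqrt (∑ m ∈ Finset.range (M + 1), ∫ x, ∑ i, dnormSq m (fun z => a z i - b z i) x) +
      9 * (M + 1) ^ 2 * 6 ^ M * Bb * (∑ m ∈ Finset.range (M + 1), ∫ x, ∑ i, dnormSq m (fun z => a z i - b z i) x) +
      9 * M * 6 ^ M * 3 ^ (M + 1) * K * Real.sqrt (∑ m ∈ Finset.range (M + 1), ∫ x, ∑ i, dnormSq m (fun z => a z i - b z i) x) ^ 3 := by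
    intro n hn
    have hnM : n ≤ M := Nat.lt_succ_iff.1 (Finset.mem_range.1 hn)
    have h3 : (3 : ℝ) ^ n ≤ 3 ^ M := pow_le_pow_right₀ (by norm_num) hnM
    have h6 : (3 : ℝ) ^ n * 2 ^ n ≤ 6 ^ M := by
      rw [← mul_pow]; norm_num; exact pow_le_pow_right₀ (by norm_num) hnM
    have hnM' : (n : ℝ) ≤ M := by exact_mod_cast hnM
    have hn1 : ((n : ℝ) + 1) ^ 2 ≤ ((M : ℝ) + 1) ^ 2 := by nlinarith
    have t2 : 3 ^ n * (ν * 9 * Real.sqrt IB * Real.sqrt (∑ m ∈ Finset.range (M + 1), ∫ x, ∑ i, dnormSq m (fun z => a z i - b z i) x)) ≤ ν * (9 * 3 ^ M * Real.sqrt IB) * Real.sqrt (∑ m ∈ Finset.range (M + 1), ∫ x, ∑ i, dnormSq m (fun z => a z i - b z i) x) := by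
      have := mul_le_mul_of_nonneg_right h3 (by positivity : (0 : ℝ) ≤ ν * 9 * Real.sqrt IB * Real.sqrt (∑ m ∈ Finset.range (M + 1), ∫ x, ∑ i, dnormSq m (fun z => a z i - b z i) x))
      linarith
    have t3 : 3 ^ n * (2 ^ n * 9 * Bb * (n + 1) ^ 2 * (∑ m ∈ Finset.range (M + 1), ∫ x, ∑ i, dnormSq m (fun z => a z i - b z i) x)) ≤ 9 * (M + 1) ^ 2 * 6 ^ M * Bb * (∑ m ∈ Finset.range (M + 1), ∫ x, ∑ i, dnormSq m (fun z => a z i - b z i) x) := by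
      have e : (3 : ℝ) ^ n * (2 ^ n * 9 * Bb * (n + 1) ^ 2 * (∑ m ∈ Finset.range (M + 1), ∫ x, ∑ i, dnormSq m (fun z => a z i - b z i) x)) = (3 ^ n * 2 ^ n) * ((n + 1) ^ 2) * (9 * Bb * (∑ m ∈ Finset.range (M + 1), ∫ x, ∑ i, dnormSq m (fun z => a z i - b z i) x)) := by
        ring
      rw [e]
      have := mul_le_mul h6 hn1 (by positivity) (by positivity)
      have := mul_le_mul_of_nonneg_right this (by positivity : (0 : ℝ) ≤ 9 * Bb * (∑ m ∈ Finset.range (M + 1), ∫ x, ∑ i, dnormSq m (fun z => a z i - b z i) x))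
      linarith
    have t4 : 3 ^ n * (2 ^ n * 9 * n * (3 ^ (M + 1) * K) * Real.sqrt (∑ m ∈ Finset.range (M + 1), ∫ x, ∑ i, dnormSq m (fun z => a z i - b z i) x) ^ 3) ≤
        9 * M * 6 ^ M * 3 ^ (M + 1) * K * Real.sqrt (∑ m ∈ Finset.range (M + 1), ∫ x, ∑ i, dnormSq m (fun z => a z i - b z i) x) ^ 3 := by
      have e : (3 : ℝ) ^ n * (2 ^ n * 9 * n * (3 ^ (M + 1) * K) * Real.sqrt (∑ m ∈ Finset.range (M + 1), ∫ x, ∑ i, dnormSq m (fun z => a z i - b z i) x) ^ 3) =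
          (3 ^ n * 2 ^ n) * n * (9 * (3 ^ (M + 1) * K) * Real.sqrt (∑ m ∈ Finset.range (M + 1), ∫ x, ∑ i, dnormSq m (fun z => a z i - b z i) x) ^ 3) := by ring
      rw [e]
      have := mul_le_mul h6 hnM' (by positivity) (by positivity)
      have := mul_le_mul_of_nonneg_right this (by positivity : (0 : ℝ) ≤ 9 * (3 ^ (M + 1) * K) * Real.sqrt (∑ m ∈ Finset.range (M + 1), ∫ x, ∑ i, dnormSq m (fun z => a z i - b z i) x) ^ 3)
      linarith
    linarith
  refine (Finset.sum_le_sum hcoef).trans (le_of_eq ?_)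
  rw [Finset.sum_add_distrib, Finset.sum_add_distrib, Finset.sum_add_distrib, ← Finset.mul_sum,
    Finset.sum_const, Finset.sum_const, Finset.sum_const, Finset.card_range, nsmul_eq_mul, nsmul_eq_mul,
    nsmul_eq_mul]
  push_cast
  ring

end Total

/-! ## Time-dependent part: the integrated energy inequality for the difference -/

section Energy

variable {S ν : ℝ} {u U : ℝ → EuclideanSpace ℝ (Fin 3) → EuclideanSpace ℝ (Fin 3)}
  {p P : ℝ → EuclideanSpace ℝ (Fin 3) → ℝ}

/-- `|∇ᵏ(f − g)|² ≤ 2|∇ᵏf|² + 2|∇ᵏg|²` pointwise. [folklore] -/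
theorem constantin_dnormSq_sub_le {f g : EuclideanSpace ℝ (Fin 3) → ℝ} (hf : ContDiff ℝ ∞ f) (hg : ContDiff ℝ ∞ g) (k : ℕ)
    (x : EuclideanSpace ℝ (Fin 3)) :
    dnormSq k (fun y => f y - g y) x ≤ 2 * dnormSq k f x + 2 * dnormSq k g x := by
  simp only [dnormSq, Finset.mul_sum, ← Finset.sum_add_distrib]
  refine Finset.sum_le_sum fun γ _ => ?_
  rw [congrFun (ipderiv_sub hf hg γ) x]
  nlinarith [sq_nonneg (ipderiv γ f x + ipderiv γ g x)]

/-- **The level integrals of the difference are finite in the class**: if `|∇ᵏu(τ)|²` and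
`|∇ᵏU(τ)|²` are integrable with integrals at most `Iu`, `IU`, then
`∑ᵢ |∇ᵏ(uᵢ − Uᵢ)(τ)|²` is integrable with integral at most `2 Iu + 2 IU`. [folklore] -/
theorem constantin_integrable_levels_sub {a b : EuclideanSpace ℝ (Fin 3) → EuclideanSpace ℝ (Fin 3)} (ha : ContDiff ℝ ∞ a)
    (hb : ContDiff ℝ ∞ b) (k : ℕ) {Ia Ib : ℝ}
    (hIa : Integrable (levelSq k a) (volume : Measure (EuclideanSpace ℝ (Fin 3))) ∧ ∫ x, levelSq k a x ≤ Ia)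
    (hIb : Integrable (levelSq k b) (volume : Measure (EuclideanSpace ℝ (Fin 3))) ∧ ∫ x, levelSq k b x ≤ Ib) :
    Integrable (fun x => ∑ i, dnormSq k (fun z => a z i - b z i) x) (volume : Measure (EuclideanSpace ℝ (Fin 3))) ∧
      ∫ x, ∑ i, dnormSq k (fun z => a z i - b z i) x ≤ 2 * Ia + 2 * Ib := by
  have hA : ∀ i, ContDiff ℝ ∞ fun y => a y i := fun i => contDiff_comp_of_contDiff ha i
  have hB : ∀ i, ContDiff ℝ ∞ fun y => b y i := fun i => contDiff_comp_of_contDiff hb i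
  have hle : ∀ x, ∑ i, dnormSq k (fun z => a z i - b z i) x ≤ 2 * levelSq k a x + 2 * levelSq k b x := by
    intro x
    simp only [levelSq, Finset.mul_sum, ← Finset.sum_add_distrib]
    exact Finset.sum_le_sum fun i _ => constantin_dnormSq_sub_le (hA i) (hB i) k x
  have hnn : ∀ x, 0 ≤ ∑ i, dnormSq k (fun z => a z i - b z i) x := fun x =>
    Finset.sum_nonneg fun i _ => dnormSq_nonneg _ _ _
  have hdom : Integrable (fun x => 2 * levelSq k a x + 2 * levelSq k b x) (volume : Measure (EuclideanSpace ℝ (Fin 3))) :=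
    (hIa.1.const_mul 2).add (hIb.1.const_mul 2)
  have hcont : Continuous fun x => ∑ i, dnormSq k (fun z => a z i - b z i) x :=
    continuous_finsetSum _ fun i _ => continuous_dnormSq ((hA i).sub (hB i)) k
  have hint : Integrable (fun x => ∑ i, dnormSq k (fun z => a z i - b z i) x) (volume : Measure (EuclideanSpace ℝ (Fin 3))) :=
    hdom.mono' hcont.aestronglyMeasurable (Eventually.of_forall fun x => by
      rw [Real.norm_of_nonneg (hnn x)]; exact hle x)
  refine ⟨hint, (integral_mono hint hdom hle).trans ?_⟩
  rw [integral_add (hIa.1.const_mul 2) (hIb.1.const_mul 2), integral_const_mul, integral_const_mul]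
  linarith [hIa.2, hIb.2]

/-- **The time derivative of `∂^α(uᵢ − Uᵢ)` through the equations.** For classical unforced
solutions `(u, p)` (viscosity `ν`) and `(U, P)` (viscosity `0`, Euler) on `[0, S] × ℝ³`,
`∂ₜ∂^α(uᵢ − Uᵢ) = ∂^α(νΔuᵢ − ∂ᵢp − (u·∇)uᵢ) − ∂^α(0·ΔUᵢ − ∂ᵢP − (U·∇)Uᵢ)` at every
`τ ∈ [0, S]` (mixed partials commute, `EnergyToolkit`; the momentum equations componentwise,
`timeDerivWithin_comp_eq`): Constantin 1986, (1.7). [cite: Constantin1986, §1 (1.7)] -/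
theorem constantin_timeDerivWithin_ipderiv_sub_eq (hu : IsClassicalNSSolutionOn (Icc 0 S) ν 0 u p)
    (hU : IsClassicalNSSolutionOn (Icc 0 S) 0 0 U P) (hS : 0 < S) {n : ℕ} (α : Fin n → Fin 3) (i : Fin 3)
    {τ : ℝ} (hτ : τ ∈ Icc 0 S) (x : EuclideanSpace ℝ (Fin 3)) :
    timeDerivWithin (Icc 0 S) (fun s y => ipderiv α (fun z => u s z i - U s z i) y) τ x =
      ipderiv α (fun y => ν * ∑ j, pderiv j (pderiv j fun z => u τ z i) y - pderiv i (p τ) y -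
          ∑ j, u τ y j * pderiv j (fun z => u τ z i) y) x -
        ipderiv α (fun y => 0 * ∑ j, pderiv j (pderiv j fun z => U τ z i) y - pderiv i (P τ) y -
          ∑ j, U τ y j * pderiv j (fun z => U τ z i) y) x := by
  have hUD : UniqueDiffOn ℝ (Icc 0 S) := uniqueDiffOn_Icc hS
  have hcl : Icc 0 S ⊆ closure (interior (Icc 0 S)) := by rw [interior_Icc, closure_Ioo hS.ne]
  have hsm_u : IsSmoothSpaceTimeOn (Icc 0 S) fun s y => u s y i := hu.isSmoothSpaceTimeOn_comp i
  have hsm_U : IsSmoothSpaceTimeOn (Icc 0 S) fun s y => U s y i := hU.isSmoothSpaceTimeOn_comp i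
  have hsm_w : IsSmoothSpaceTimeOn (Icc 0 S) fun s y => u s y i - U s y i := hsm_u.sub hsm_U
  rw [hsm_w.timeDerivWithin_ipderiv_slice hUD hcl α hτ x]
  have hT : timeDerivWithin (Icc 0 S) (fun s y => u s y i - U s y i) τ =
      fun y => timeDerivWithin (Icc 0 S) (fun s y => u s y i) τ y -
        timeDerivWithin (Icc 0 S) (fun s y => U s y i) τ y :=
    funext fun y => hsm_u.timeDerivWithin_fun_sub hsm_U hUD hτ y
  rw [hT, hu.timeDerivWithin_comp_eq hUD hτ i, hU.timeDerivWithin_comp_eq hUD hτ i]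
  -- split `∂^α` over the difference of the two smooth right-hand sides
  have hA : ∀ j, ContDiff ℝ ∞ fun y => u τ y j := fun j => contDiff_comp_of_contDiff (hu.contDiff_velocity hτ) j
  have hB : ∀ j, ContDiff ℝ ∞ fun y => U τ y j := fun j => contDiff_comp_of_contDiff (hU.contDiff_velocity hτ) j
  have hdA : ∀ j l, ContDiff ℝ ∞ (pderiv l fun y => u τ y j) := fun j l => contDiff_pderiv (hA j) l
  have hdB : ∀ j l, ContDiff ℝ ∞ (pderiv l fun y => U τ y j) := fun j l => contDiff_pderiv (hB j) l
  have hF₁ : ContDiff ℝ ∞ fun y => ν * ∑ j, pderiv j (pderiv j fun z => u τ z i) y - pderiv i (p τ) y -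
      ∑ j, u τ y j * pderiv j (fun z => u τ z i) y :=
    ((contDiff_const.mul (ContDiff.sum fun j _ => contDiff_pderiv (hdA i j) j)).sub
      (contDiff_pderiv (hu.contDiff_pressure hτ) i)).sub (ContDiff.sum fun j _ => (hA j).mul (hdA i j))
  have hF₂ : ContDiff ℝ ∞ fun y => 0 * ∑ j, pderiv j (pderiv j fun z => U τ z i) y - pderiv i (P τ) y -
      ∑ j, U τ y j * pderiv j (fun z => U τ z i) y :=
    ((contDiff_const.mul (ContDiff.sum fun j _ => contDiff_pderiv (hdB i j) j)).sub
      (contDiff_pderiv (hU.contDiff_pressure hτ) i)).sub (ContDiff.sum fun j _ => (hB j).mul (hdB i j))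
  have e := congrFun (ipderiv_sub hF₁ hF₂ α) x
  simp only at e
  rw [← e]

/-- Continuity in time of the localised pairings `τ ↦ ∫ χ_R ∂ₜW W` for `W = ∂^α(uᵢ − Uᵢ)`. [folklore] -/
theorem constantin_continuousOn_integral_cutoff_pairing (hu : IsClassicalNSSolutionOn (Icc 0 S) ν 0 u p)
    (hU : IsClassicalNSSolutionOn (Icc 0 S) 0 0 U P) (hS : 0 < S) {R : ℝ} (hR : 0 < R) {n : ℕ}
    (α : Fin n → Fin 3) (i : Fin 3) :
    ContinuousOn (fun τ => ∫ x, cutoff R x *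
      (timeDerivWithin (Icc 0 S) (fun s y => ipderiv α (fun z => u s z i - U s z i) y) τ x *
        ipderiv α (fun z => u τ z i - U τ z i) x)) (Icc 0 S) := by
  have hUD : UniqueDiffOn ℝ (Icc 0 S) := uniqueDiffOn_Icc hS
  have hW : IsSmoothSpaceTimeOn (Icc 0 S) fun s y => ipderiv α (fun z => u s z i - U s z i) y :=
    ((hu.isSmoothSpaceTimeOn_comp i).sub (hU.isSmoothSpaceTimeOn_comp i)).ipderiv_slice hUD α
  have hWt := hW.timeDerivWithin hUD
  exact continuousOn_integral_mul_of_continuousOn (contDiff_cutoff (n := 0) R).continuous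
    (hasCompactSupport_cutoff hR) (hWt.continuousOn.mul hW.continuousOn)

/-- **The localised energy identity in time, summed over words and levels.** For classical
unforced solutions `(u, p)` (viscosity `ν`) and `(U, P)` (Euler) on `[0, S] × ℝ³` with the same
datum `u 0 = U 0`, and `W_{α,i} = ∂^α(uᵢ − Uᵢ)`:
`∑_{n≤M} ∑_α ∑ᵢ ∫ χ_R W_{α,i}(t)² = 2 ∫₀ᵗ ∑_{n≤M} ∑_α ∑ᵢ ∫ χ_R Ẇ_{α,i} W_{α,i}`, the time
derivatives `Ẇ` being expressed through the equations (`constantin_timeDerivWithin_ipderiv_sub_eq`)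
(fundamental theorem of calculus on time lines and Fubini, `EnergyToolkit`; Constantin 1986,
(1.10)–(1.11) integrated from `w(0) = 0`). [cite: Constantin1986, §1 (1.10)-(1.11)] -/
theorem constantin_sum_integral_cutoff_sq_eq (hu : IsClassicalNSSolutionOn (Icc 0 S) ν 0 u p)
    (hU : IsClassicalNSSolutionOn (Icc 0 S) 0 0 U P) (hS : 0 < S) (h0 : u 0 = U 0) {R : ℝ} (hR : 0 < R)
    (M : ℕ) {t : ℝ} (ht : t ∈ Icc 0 S) :
    ∑ n ∈ Finset.range (M + 1), ∑ α : Fin n → Fin 3, ∑ i,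
        ∫ x, cutoff R x * ipderiv α (fun z => u t z i - U t z i) x ^ 2 =
      2 * ∫ τ in Ioo 0 t, ∑ n ∈ Finset.range (M + 1), ∑ α : Fin n → Fin 3, ∑ i, ∫ x, cutoff R x *
        ((ipderiv α (fun y => ν * ∑ j, pderiv j (pderiv j fun z => u τ z i) y - pderiv i (p τ) y -
              ∑ j, u τ y j * pderiv j (fun z => u τ z i) y) x -
            ipderiv α (fun y => 0 * ∑ j, pderiv j (pderiv j fun z => U τ z i) y - pderiv i (P τ) y -
              ∑ j, U τ y j * pderiv j (fun z => U τ z i) y) x) *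
          ipderiv α (fun z => u τ z i - U τ z i) x) := by
  have hUD : UniqueDiffOn ℝ (Icc 0 S) := uniqueDiffOn_Icc hS
  have h0S : (0 : ℝ) ∈ Icc 0 S := ⟨le_rfl, hS.le⟩
  have hφc : Continuous (cutoff (E := EuclideanSpace ℝ (Fin 3)) R) := (contDiff_cutoff (n := 0) R).continuous
  have hφs : HasCompactSupport (cutoff (E := EuclideanSpace ℝ (Fin 3)) R) := hasCompactSupport_cutoff hR
  -- the pairing for one `(α, i)`, with the time derivative
  set F : (n : ℕ) → (Fin n → Fin 3) → Fin 3 → ℝ → ℝ := fun n α i τ => ∫ x, cutoff R x *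
    (timeDerivWithin (Icc 0 S) (fun s y => ipderiv α (fun z => u s z i - U s z i) y) τ x *
      ipderiv α (fun z => u τ z i - U τ z i) x) with hF
  have hFcont : ∀ n (α : Fin n → Fin 3) i, ContinuousOn (F n α i) (Icc 0 S) := fun n α i =>
    constantin_continuousOn_integral_cutoff_pairing hu hU hS hR α i
  have hFint : ∀ n (α : Fin n → Fin 3) i, IntegrableOn (F n α i) (Ioo 0 t) := fun n α i =>
    (((hFcont n α i).mono (Icc_subset_Icc le_rfl ht.2)).integrableOn_compact isCompact_Icc).mono_set
      Ioo_subset_Icc_self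
  -- FTC for one `(α, i)`: the datum term vanishes
  have hW0 : ∀ n (α : Fin n → Fin 3) i x, ipderiv α (fun z => u 0 z i - U 0 z i) x = 0 := by
    intro n α i x
    have : (fun z => u 0 z i - U 0 z i) = fun _ => (0 : ℝ) := by
      funext z; rw [h0]; ring
    rw [this, ipderiv_zero_fun]
  have hFTC : ∀ n (α : Fin n → Fin 3) i, ∫ τ in Ioo 0 t, F n α i τ =
      2⁻¹ * ∫ x, cutoff R x * ipderiv α (fun z => u t z i - U t z i) x ^ 2 := by
    intro n α i
    have hW : IsSmoothSpaceTimeOn (Icc 0 S) fun s y => ipderiv α (fun z => u s z i - U s z i) y :=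
      ((hu.isSmoothSpaceTimeOn_comp i).sub (hU.isSmoothSpaceTimeOn_comp i)).ipderiv_slice hUD α
    have h := hW.integral_Ioo_integral_mul_timeDerivWithin_mul hS hφc hφs le_rfl ht.1 ht.2
    rw [hF]
    simp only at h ⊢
    rw [h]
    simp [hW0]
  -- sum over the finite index set
  have hsum : ∫ τ in Ioo 0 t, ∑ n ∈ Finset.range (M + 1), ∑ α : Fin n → Fin 3, ∑ i, F n α i τ =
      ∑ n ∈ Finset.range (M + 1), ∑ α : Fin n → Fin 3, ∑ i, ∫ τ in Ioo 0 t, F n α i τ := by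
    rw [integral_finsetSum _ fun n _ => ?_]
    · refine Finset.sum_congr rfl fun n _ => ?_
      rw [integral_finsetSum _ fun α _ => ?_]
      · refine Finset.sum_congr rfl fun α _ => ?_
        exact integral_finsetSum _ fun i _ => hFint n α i
      · exact integrable_finsetSum _ fun i _ => hFint n α i
    · exact integrable_finsetSum _ fun α _ => integrable_finsetSum _ fun i _ => hFint n α i
  -- replace the time derivatives by the equations inside the time integral
  have hrepl : ∫ τ in Ioo 0 t, ∑ n ∈ Finset.range (M + 1), ∑ α : Fin n → Fin 3, ∑ i, ∫ x, cutoff R x *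
        ((ipderiv α (fun y => ν * ∑ j, pderiv j (pderiv j fun z => u τ z i) y - pderiv i (p τ) y -
              ∑ j, u τ y j * pderiv j (fun z => u τ z i) y) x -
            ipderiv α (fun y => 0 * ∑ j, pderiv j (pderiv j fun z => U τ z i) y - pderiv i (P τ) y -
              ∑ j, U τ y j * pderiv j (fun z => U τ z i) y) x) *
          ipderiv α (fun z => u τ z i - U τ z i) x) =
      ∫ τ in Ioo 0 t, ∑ n ∈ Finset.range (M + 1), ∑ α : Fin n → Fin 3, ∑ i, F n α i τ := by
    refine setIntegral_congr_fun measurableSet_Ioo fun τ hτ => ?_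
    have hτ' : τ ∈ Icc 0 S := ⟨hτ.1.le, hτ.2.le.trans ht.2⟩
    refine Finset.sum_congr rfl fun n _ => Finset.sum_congr rfl fun α _ => Finset.sum_congr rfl fun i _ => ?_
    rw [hF]
    refine integral_congr_ae (Eventually.of_forall fun x => ?_)
    simp only
    rw [constantin_timeDerivWithin_ipderiv_sub_eq hu hU hS α i hτ' x]
  rw [hrepl, hsum]
  simp only [hFTC, ← Finset.mul_sum]
  ring

/-- **Level integrals as sums over words**: `∑_{m≤M} ∫ ∑ᵢ |∇ᵐwᵢ|² = ∑_{n≤M} ∑_α ∑ᵢ ∫ (∂^α wᵢ)²`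
(finite sums out of the integral). [folklore] -/
theorem constantin_sum_levels_eq_sum_words {w : Fin 3 → EuclideanSpace ℝ (Fin 3) → ℝ} (hw : ∀ i, ContDiff ℝ ∞ (w i))
    (hI : ∀ m, Integrable (fun x => ∑ i, dnormSq m (w i) x) (volume : Measure (EuclideanSpace ℝ (Fin 3)))) (M : ℕ) :
    ∑ m ∈ Finset.range (M + 1), ∫ x, ∑ i, dnormSq m (w i) x =
      ∑ n ∈ Finset.range (M + 1), ∑ α : Fin n → Fin 3, ∑ i, ∫ x, ipderiv α (w i) x ^ 2 := by
  refine Finset.sum_congr rfl fun m _ => ?_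
  have hint : ∀ i (α : Fin m → Fin 3), Integrable (fun x => ipderiv α (w i) x ^ 2)
      (volume : Measure (EuclideanSpace ℝ (Fin 3))) := fun i α =>
    (memLp_two_iff_integrable_sq (continuous_ipderiv (hw i) α).aestronglyMeasurable).1
      (constantin_memLp_ipderiv_and_le hw (hI m) α i).1
  rw [integral_finsetSum _ fun i _ => ?_]
  · rw [Finset.sum_comm]
    refine Finset.sum_congr rfl fun i _ => ?_
    simp only [dnormSq]
    exact integral_finsetSum _ fun α _ => hint i α
  · exact integrable_finsetSum _ fun α _ => hint i α

/-- **Removing the cutoff in the summed energies**: `∑ ∫ χ_R (∂^α wᵢ)² → ∑ ∫ (∂^α wᵢ)²` as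
`R → ∞`. [folklore] -/
theorem constantin_tendsto_sum_integral_cutoff_sq {w : Fin 3 → EuclideanSpace ℝ (Fin 3) → ℝ} (hw : ∀ i, ContDiff ℝ ∞ (w i))
    (hI : ∀ m, Integrable (fun x => ∑ i, dnormSq m (w i) x) (volume : Measure (EuclideanSpace ℝ (Fin 3)))) (M : ℕ) :
    Tendsto (fun R : ℝ => ∑ n ∈ Finset.range (M + 1), ∑ α : Fin n → Fin 3, ∑ i,
        ∫ x, cutoff R x * ipderiv α (w i) x ^ 2) atTop
      (nhds (∑ n ∈ Finset.range (M + 1), ∑ α : Fin n → Fin 3, ∑ i, ∫ x, ipderiv α (w i) x ^ 2)) := by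
  refine tendsto_finsetSum _ fun n _ => tendsto_finsetSum _ fun α _ => tendsto_finsetSum _ fun i _ => ?_
  have hint : Integrable (fun x => ipderiv α (w i) x ^ 2) (volume : Measure (EuclideanSpace ℝ (Fin 3))) :=
    (memLp_two_iff_integrable_sq (continuous_ipderiv (hw i) α).aestronglyMeasurable).1
      (constantin_memLp_ipderiv_and_le hw (hI n) α i).1
  have h := tendsto_integral_cutoff_pow_mul_atTop hint 1
  simp only [pow_one] at h
  exact h

/-- A sup bound of the Fréchet tensor bounds the coordinate norms of the components:
`‖Dᵏv(x)‖ ≤ B ⟹ |∇ᵏvᵢ(x)| ≤ 3ᵏ B`. [folklore] -/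
theorem constantin_dnorm_comp_le_of_norm_iteratedFDeriv_le {v : EuclideanSpace ℝ (Fin 3) → EuclideanSpace ℝ (Fin 3)}
    (hv : ContDiff ℝ ∞ v) {k : ℕ} {B : ℝ} {x : EuclideanSpace ℝ (Fin 3)} (hB : ‖iteratedFDeriv ℝ k v x‖ ≤ B)
    (i : Fin 3) : dnorm k (fun y => v y i) x ≤ 3 ^ k * B := by
  have hvi : ContDiff ℝ ∞ fun y => v y i := contDiff_comp_of_contDiff hv i
  have hB0 : 0 ≤ B := (norm_nonneg _).trans hB
  have h1 : dnormSq k (fun y => v y i) x ≤ 3 ^ k * ‖iteratedFDeriv ℝ k (fun y => v y i) x‖ ^ 2 := by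
    have := dnormSq_le_card_pow_mul_sq_norm_iteratedFDeriv hvi k x
    simpa [Fintype.card_fin] using this
  have h2 : ‖iteratedFDeriv ℝ k (fun y => v y i) x‖ ≤ B := (norm_iteratedFDeriv_apply_le hv i k x).trans hB
  have h3 : dnormSq k (fun y => v y i) x ≤ (3 ^ k * B) ^ 2 := by
    calc dnormSq k (fun y => v y i) x ≤ 3 ^ k * B ^ 2 := h1.trans (by gcongr)
      _ ≤ (3 ^ k * B) ^ 2 := by
          rw [mul_pow]
          refine mul_le_mul_of_nonneg_right ?_ (sq_nonneg _)
          calc (3 : ℝ) ^ k = (3 ^ k) ^ 1 := (pow_one _).symm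
            _ ≤ (3 ^ k) ^ 2 := pow_le_pow_right₀ (one_le_pow₀ (by norm_num)) one_le_two
  rw [dnorm]
  exact Real.sqrt_le_iff.2 ⟨by positivity, h3⟩

/-- Monotonicity of the cutoff-error quantity in the level integrals and in `‖Q‖₂`. [folklore] -/
theorem constantin_errorTotal_mono {L J : ℕ → ℝ} (hL0 : ∀ k, 0 ≤ L k) (hLJ : ∀ k, L k ≤ J k) {Ba ν sQ q : ℝ}
    (hBa : 0 ≤ Ba) (hν : 0 ≤ ν) (hq0 : 0 ≤ q) (hsQ : sQ ≤ q) (M : ℕ) :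
    ∑ n ∈ Finset.range (M + 1), 3 ^ n *
        (2⁻¹ * 9 * Ba * L n + ν * 9 * Real.sqrt (L n) * Real.sqrt (L (n + 1)) +
          2 ^ n * sQ * Real.sqrt (9 * (n + 1) * ∑ k ∈ Finset.range (n + 1), L (n - k + n))) ≤
      ∑ n ∈ Finset.range (M + 1), 3 ^ n *
        (2⁻¹ * 9 * Ba * J n + ν * 9 * Real.sqrt (J n) * Real.sqrt (J (n + 1)) +
          2 ^ n * q * Real.sqrt (9 * (n + 1) * ∑ k ∈ Finset.range (n + 1), J (n - k + n))) := by
  have hJ0 : ∀ k, 0 ≤ J k := fun k => (hL0 k).trans (hLJ k)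
  refine Finset.sum_le_sum fun n _ => mul_le_mul_of_nonneg_left ?_ (by positivity)
  gcongr
  · exact hLJ n
  · exact hLJ n
  · exact hLJ (n + 1)
  · exact hLJ _

/-- **The integrated `H^M` energy inequality for the difference of a Navier–Stokes and an Euler
solution** (Constantin 1986, (1.10)–(1.11) integrated in time, in the tree's BKM class). Let
`(u, p)` be a classical unforced Navier–Stokes solution (viscosity `ν ≥ 0`) and `(U, P)` a
classical unforced Euler solution on `[0, S] × ℝ³`, `u` with all `L²` Sobolev seminorms bounded
on `[0, S]`, with the same datum `u 0 = U 0`; let `M ≥ 4`, let `I_U(k)` bound `∫|∇ᵏU(τ)|²`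
(coordinate tensors) and `B_U(k)` bound `‖DᵏU(τ, x)‖` on the slab, and let `K` be the Sobolev
constant of `exists_abs_le_sobolev_dnormSq`. Then the total level energy of `w = u − U`,
`Y(t) = ∑_{m≤M} ∫ ∑ᵢ |∇ᵐwᵢ(t)|²`, satisfies for every `t ∈ [0, S]`
`Y(t) ≤ 2 ∫₀ᵗ (ν A √Y + B Y + K' (√Y)³) dτ` (lower Lebesgue integral of the majorant), with
`A = 9(M+1)3^M √(∑_{k≤M+2} I_U(k))`, `B = 9(M+1)³6^M ∑_{k≤M+1} 3ᵏB_U(k)`,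
`K' = 9M(M+1)6^M 3^(M+1) K` — constants depending only on `M`, `U` and `K`, not on `ν`, `S`
or `u`. Proof: the localised identity `constantin_sum_integral_cutoff_sq_eq`, the total slice
inequality `constantin_slice_total_pairing_le` at interior times (pressures normalised by the
tree's `pressure_sub_pressurePotential_eq`, `ν ≥ 0`), cutoff errors `O(1/R)` uniformly on the
slab by the class bounds, and `R → ∞`. [cite: Constantin1986, §1 (1.10)-(1.11)] -/
theorem constantin_levels_le_lintegral (hu : IsClassicalNSSolutionOn (Icc 0 S) ν 0 u p)
    (hU : IsClassicalNSSolutionOn (Icc 0 S) 0 0 U P) (hS : 0 < S) (hν : 0 ≤ ν)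
    (huB : HasBoundedSobolevNormsOn (Icc 0 S) u)
    (h0 : u 0 = U 0) {K : ℝ} (hK0 : 0 ≤ K)
    (hK : ∀ f : EuclideanSpace ℝ (Fin 3) → ℝ, ContDiff ℝ ∞ f →
      (∀ j ∈ Finset.range 3, Integrable (dnormSq j f) (volume : Measure (EuclideanSpace ℝ (Fin 3)))) →
      ∀ x, |f x| ≤ K * ∑ j ∈ Finset.range 3, Real.sqrt (∫ y, dnormSq j f y))
    {M : ℕ} (hM : 4 ≤ M) {IU : ℕ → ℝ}
    (hIU : ∀ k, ∀ τ ∈ Icc 0 S, Integrable (levelSq k (U τ)) (volume : Measure (EuclideanSpace ℝ (Fin 3))) ∧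
      ∫ x, levelSq k (U τ) x ≤ IU k)
    {BU : ℕ → ℝ} (hBU : ∀ k, ∀ τ ∈ Icc 0 S, ∀ x, ‖iteratedFDeriv ℝ k (U τ) x‖ ≤ BU k)
    {t : ℝ} (ht : t ∈ Icc 0 S) :
    (∑ m ∈ Finset.range (M + 1), ∫ x, ∑ i, dnormSq m (fun z => u t z i - U t z i) x) ≤
      2 * (∫⁻ τ in Ioo 0 t, ENNReal.ofReal
        (ν * (9 * (M + 1) * 3 ^ M * Real.sqrt (∑ k ∈ Finset.range (M + 3), IU k)) * Real.sqrt (∑ m ∈ Finset.range (M + 1), ∫ x, ∑ i, dnormSq m (fun z => u τ z i - U τ z i) x) + (9 * (M + 1) ^ 3 * 6 ^ M * (∑ k ∈ Finset.range (M + 2), 3 ^ k * BU k)) * (∑ m ∈ Finset.range (M + 1), ∫ x, ∑ i, dnormSq m (fun z => u τ z i - U τ z i) x) + (9 * M * (M + 1) * 6 ^ M * 3 ^ (M + 1) * K) * Real.sqrt (∑ m ∈ Finset.range (M + 1), ∫ x, ∑ i, dnormSq m (fun z => u τ z i - U τ z i) x) ^ 3)).toReal := by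
  have hUD : UniqueDiffOn ℝ (Icc 0 S) := uniqueDiffOn_Icc hS
  have h0S : (0 : ℝ) ∈ Icc 0 S := ⟨le_rfl, hS.le⟩
  have hu_s : ∀ τ ∈ Icc 0 S, ContDiff ℝ ∞ (u τ) := fun τ hτ => hu.contDiff_velocity hτ
  have hU_s : ∀ τ ∈ Icc 0 S, ContDiff ℝ ∞ (U τ) := fun τ hτ => hU.contDiff_velocity hτ
  have hw_s : ∀ τ ∈ Icc 0 S, ∀ i, ContDiff ℝ ∞ fun z => u τ z i - U τ z i := fun τ hτ i =>
    (contDiff_comp_of_contDiff (hu_s τ hτ) i).sub (contDiff_comp_of_contDiff (hU_s τ hτ) i)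
  -- class constants of `u`
  have hIu_ex := fun k => (levelSq_bounds_of_hasBoundedSobolevNormsOn hu_s huB k).1
  choose Iu hIu using hIu_ex
  obtain ⟨B0, hB00, hB0⟩ := exists_forall_norm_iteratedFDeriv_le_bkmClass hu_s huB 0
  have huB0 : ∀ τ ∈ Icc 0 S, ∀ x, ‖u τ x‖ ≤ B0 := fun τ hτ x => by
    have := hB0 τ hτ x; rwa [norm_iteratedFDeriv_zero] at this
  have hUB0 : ∀ τ ∈ Icc 0 S, ∀ x, ‖U τ x‖ ≤ BU 0 := fun τ hτ x => by
    have := hBU 0 τ hτ x; rwa [norm_iteratedFDeriv_zero] at this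
  -- nonnegativity of the constants
  have hlev0 : ∀ (v : EuclideanSpace ℝ (Fin 3) → EuclideanSpace ℝ (Fin 3)) k, 0 ≤ ∫ x, levelSq k v x :=
    fun v k => integral_nonneg fun x => levelSq_nonneg k v x
  have hIU0 : ∀ k, 0 ≤ IU k := fun k => (hlev0 _ k).trans (hIU k 0 h0S).2
  have hIu0 : ∀ k, 0 ≤ Iu k := fun k => (hlev0 _ k).trans (hIu k 0 h0S).2
  have hBU0 : ∀ k, 0 ≤ BU k := fun k => (norm_nonneg _).trans (hBU k 0 h0S 0)
  -- level data of the difference and of `U`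
  have hJ : ∀ τ ∈ Icc 0 S, ∀ k,
      Integrable (fun x => ∑ i, dnormSq k (fun z => u τ z i - U τ z i) x) (volume : Measure (EuclideanSpace ℝ (Fin 3))) ∧
      ∫ x, ∑ i, dnormSq k (fun z => u τ z i - U τ z i) x ≤ 2 * Iu k + 2 * IU k := fun τ hτ k =>
    constantin_integrable_levels_sub (hu_s τ hτ) (hU_s τ hτ) k (hIu k τ hτ) (hIU k τ hτ)
  have hIbU : ∀ τ ∈ Icc 0 S, ∀ k, Integrable (fun x => ∑ i, dnormSq k (fun y => U τ y i) x)
      (volume : Measure (EuclideanSpace ℝ (Fin 3))) := fun τ hτ k => (hIU k τ hτ).1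
  have hIB : ∀ τ ∈ Icc 0 S, ∀ k, k ≤ M + 2 →
      (∫ x, ∑ i, dnormSq k (fun y => U τ y i) x) ≤ ∑ k ∈ Finset.range (M + 3), IU k := by
    intro τ hτ k hk
    exact (hIU k τ hτ).2.trans (Finset.single_le_sum (f := IU) (fun k _ => hIU0 k)
      (Finset.mem_range.2 (by omega)))
  have hBb0 : 0 ≤ ∑ k ∈ Finset.range (M + 2), (3 : ℝ) ^ k * BU k :=
    Finset.sum_nonneg fun k _ => mul_nonneg (by positivity) (hBU0 k)
  have hBb : ∀ τ ∈ Icc 0 S, ∀ k, k ≤ M + 1 → ∀ i x,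
      dnorm k (fun y => U τ y i) x ≤ ∑ k ∈ Finset.range (M + 2), (3 : ℝ) ^ k * BU k := by
    intro τ hτ k hk i x
    exact (constantin_dnorm_comp_le_of_norm_iteratedFDeriv_le (hU_s τ hτ) (hBU k τ hτ x) i).trans
      (Finset.single_le_sum (f := fun k => (3 : ℝ) ^ k * BU k) (fun k _ => mul_nonneg (by positivity) (hBU0 k))
        (Finset.mem_range.2 (by omega)))
  have hBa : ∀ τ ∈ Icc 0 S, ∀ x j, |u τ x j| ≤ B0 := fun τ hτ x j =>
    (abs_apply_le_norm' (u τ x) j).trans (huB0 τ hτ x)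
  -- divergence free in coordinates
  have hdivu : ∀ τ ∈ Icc 0 S, ∀ x, ∑ j, pderiv j (fun y => u τ y j) x = 0 := fun τ hτ x =>
    hu.sum_pderiv_comp_eq_zero hτ x
  have hdivU : ∀ τ ∈ Icc 0 S, ∀ x, ∑ j, pderiv j (fun y => U τ y j) x = 0 := fun τ hτ x =>
    hU.sum_pderiv_comp_eq_zero hτ x
  -- energies and normalised pressures
  have hE_int_u : ∀ τ ∈ Icc 0 S, Integrable (fun y => ‖u τ y‖ ^ 2) (volume : Measure (EuclideanSpace ℝ (Fin 3))) :=
    fun τ hτ => (hIu 0 τ hτ).1.congr (Eventually.of_forall fun x => levelSq_zero_eq_norm_sq (u τ) x)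
  have hE_le_u : ∀ τ ∈ Icc 0 S, ∫ y, ‖u τ y‖ ^ 2 ≤ Iu 0 := fun τ hτ => by
    rw [← integral_congr_ae (Eventually.of_forall fun x => levelSq_zero_eq_norm_sq (u τ) x)]
    exact (hIu 0 τ hτ).2
  have hE_int_U : ∀ τ ∈ Icc 0 S, Integrable (fun y => ‖U τ y‖ ^ 2) (volume : Measure (EuclideanSpace ℝ (Fin 3))) :=
    fun τ hτ => (hIU 0 τ hτ).1.congr (Eventually.of_forall fun x => levelSq_zero_eq_norm_sq (U τ) x)
  have hE_le_U : ∀ τ ∈ Icc 0 S, ∫ y, ‖U τ y‖ ^ 2 ≤ IU 0 := fun τ hτ => by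
    rw [← integral_congr_ae (Eventually.of_forall fun x => levelSq_zero_eq_norm_sq (U τ) x)]
    exact (hIU 0 τ hτ).2
  have hQu : ∀ τ ∈ Ioo 0 S, ∀ x,
      p τ x = normalisedPressure (u τ) x + (p τ 0 - pressurePotential (u τ) 0) := by
    intro τ hτ x
    have hτ' : τ ∈ Icc 0 S := Ioo_subset_Icc_self hτ
    have h1 := pressure_sub_pressurePotential_eq hν hu (hIu0 0) hE_int_u hE_le_u hτ x
    rw [normalisedPressure_eq_pressurePotential ((hu_s τ hτ').of_le (by norm_cast)) (hE_int_u τ hτ') x]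
    linarith
  have hQU : ∀ τ ∈ Ioo 0 S, ∀ x,
      P τ x = normalisedPressure (U τ) x + (P τ 0 - pressurePotential (U τ) 0) := by
    intro τ hτ x
    have hτ' : τ ∈ Icc 0 S := Ioo_subset_Icc_self hτ
    have h1 := pressure_sub_pressurePotential_eq le_rfl hU (hIU0 0) hE_int_U hE_le_U hτ x
    rw [normalisedPressure_eq_pressurePotential ((hU_s τ hτ').of_le (by norm_cast)) (hE_int_U τ hτ') x]
    linarith
  set Q0u : ℝ := (27 * regLaplacianMass) ^ 2 * (B0 ^ 2 * Iu 0) with hQ0u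
  set Q0U : ℝ := (27 * regLaplacianMass) ^ 2 * (BU 0 ^ 2 * IU 0) with hQ0U
  have hQL2u : ∀ τ ∈ Icc 0 S, Integrable (fun x => normalisedPressure (u τ) x ^ 2)
      (volume : Measure (EuclideanSpace ℝ (Fin 3))) ∧ ∫ x, normalisedPressure (u τ) x ^ 2 ≤ Q0u := fun τ hτ =>
    integral_normalisedPressure_sq_le_of_bound (hu_s τ hτ) (hE_int_u τ hτ) (hE_le_u τ hτ) (huB0 τ hτ)
  have hQL2U : ∀ τ ∈ Icc 0 S, Integrable (fun x => normalisedPressure (U τ) x ^ 2)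
      (volume : Measure (EuclideanSpace ℝ (Fin 3))) ∧ ∫ x, normalisedPressure (U τ) x ^ 2 ≤ Q0U := fun τ hτ =>
    integral_normalisedPressure_sq_le_of_bound (hU_s τ hτ) (hE_int_U τ hτ) (hE_le_U τ hτ) (hUB0 τ hτ)
  have hQ0u0 : 0 ≤ Q0u := by rw [hQ0u]; exact mul_nonneg (sq_nonneg _) (mul_nonneg (sq_nonneg _) (hIu0 0))
  have hQ0U0 : 0 ≤ Q0U := by rw [hQ0U]; exact mul_nonneg (sq_nonneg _) (mul_nonneg (sq_nonneg _) (hIU0 0))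
  -- the `L²` pressure difference
  have hQmem : ∀ τ ∈ Icc 0 S, MemLp (fun x => normalisedPressure (u τ) x - normalisedPressure (U τ) x) 2
      (volume : Measure (EuclideanSpace ℝ (Fin 3))) := by
    intro τ hτ
    have mu : MemLp (normalisedPressure (u τ)) 2 (volume : Measure (EuclideanSpace ℝ (Fin 3))) :=
      (memLp_two_iff_integrable_sq (aestronglyMeasurable_normalisedPressure_of_integrable (hu_s τ hτ)
        (hE_int_u τ hτ))).2 (hQL2u τ hτ).1
    have mU : MemLp (normalisedPressure (U τ)) 2 (volume : Measure (EuclideanSpace ℝ (Fin 3))) :=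
      (memLp_two_iff_integrable_sq (aestronglyMeasurable_normalisedPressure_of_integrable (hU_s τ hτ)
        (hE_int_U τ hτ))).2 (hQL2U τ hτ).1
    exact mu.sub mU
  have hQ2 : ∀ τ ∈ Icc 0 S, Real.sqrt (∫ x, (normalisedPressure (u τ) x - normalisedPressure (U τ) x) ^ 2) ≤
      Real.sqrt (2 * Q0u + 2 * Q0U) := by
    intro τ hτ
    refine Real.sqrt_le_sqrt ?_
    have hle : ∀ x, (normalisedPressure (u τ) x - normalisedPressure (U τ) x) ^ 2 ≤
        2 * normalisedPressure (u τ) x ^ 2 + 2 * normalisedPressure (U τ) x ^ 2 := fun x => by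
      nlinarith [sq_nonneg (normalisedPressure (u τ) x + normalisedPressure (U τ) x)]
    have hint : Integrable (fun x => (normalisedPressure (u τ) x - normalisedPressure (U τ) x) ^ 2)
        (volume : Measure (EuclideanSpace ℝ (Fin 3))) :=
      (memLp_two_iff_integrable_sq (hQmem τ hτ).1).1 (hQmem τ hτ)
    have hdom : Integrable (fun x => 2 * normalisedPressure (u τ) x ^ 2 + 2 * normalisedPressure (U τ) x ^ 2)
        (volume : Measure (EuclideanSpace ℝ (Fin 3))) := ((hQL2u τ hτ).1.const_mul 2).add ((hQL2U τ hτ).1.const_mul 2)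
    refine (integral_mono hint hdom hle).trans ?_
    rw [integral_add ((hQL2u τ hτ).1.const_mul 2) ((hQL2U τ hτ).1.const_mul 2), integral_const_mul, integral_const_mul]
    linarith [(hQL2u τ hτ).2, (hQL2U τ hτ).2]
  -- cutoff constants
  obtain ⟨A1, hA10, hA1⟩ := exists_abs_pderiv_cutoff_le_div (ι := Fin 3)
  obtain ⟨A2, hA20, hA2⟩ := exists_dnorm_cutoff_le_of_le (ι := Fin 3) (M + 1)
  have hA0 : 0 ≤ A1 + A2 := add_nonneg hA10 hA20
  have hAR1 : ∀ R : ℝ, 1 ≤ R → ∀ (j : Fin 3) (x : EuclideanSpace ℝ (Fin 3)), |pderiv j (cutoff R) x| ≤ (A1 + A2) / R :=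
    fun R hR j x => (hA1 R hR j x).trans (div_le_div_of_nonneg_right (by linarith) (by linarith))
  have hAR : ∀ R : ℝ, 1 ≤ R → ∀ k, 1 ≤ k → k ≤ M + 1 → ∀ x : EuclideanSpace ℝ (Fin 3),
      dnorm k (cutoff R) x ≤ (A1 + A2) / R :=
    fun R hR k hk1 hk2 x => (hA2 R hR k hk1 hk2 x).trans (div_le_div_of_nonneg_right (by linarith) (by linarith))
  -- the error constant
  set Ebar : ℝ := ∑ n ∈ Finset.range (M + 1), 3 ^ n *
    (2⁻¹ * 9 * B0 * (2 * Iu n + 2 * IU n) +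
      ν * 9 * Real.sqrt (2 * Iu n + 2 * IU n) * Real.sqrt (2 * Iu (n + 1) + 2 * IU (n + 1)) +
      2 ^ n * Real.sqrt (2 * Q0u + 2 * Q0U) *
        Real.sqrt (9 * (n + 1) * ∑ k ∈ Finset.range (n + 1), (2 * Iu (n - k + n) + 2 * IU (n - k + n)))) with hEbar
  have hE0 : 0 ≤ Ebar := by
    rw [hEbar]
    refine Finset.sum_nonneg fun n _ => mul_nonneg (pow_nonneg (by norm_num) n) ?_
    have h1 : 0 ≤ 2 * Iu n + 2 * IU n := by linarith [hIu0 n, hIU0 n]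
    refine add_nonneg (add_nonneg ?_ ?_) ?_
    · exact mul_nonneg (by positivity) h1
    · exact mul_nonneg (mul_nonneg (mul_nonneg hν (by norm_num)) (Real.sqrt_nonneg _)) (Real.sqrt_nonneg _)
    · exact mul_nonneg (mul_nonneg (pow_nonneg (by norm_num) n) (Real.sqrt_nonneg _)) (Real.sqrt_nonneg _)
  -- the slice bound at interior times
  have hslice : ∀ R : ℝ, 1 ≤ R → ∀ τ ∈ Ioo 0 S,
      (∑ n ∈ Finset.range (M + 1), ∑ α : Fin n → Fin 3, ∑ i, ∫ x, cutoff R x *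
        ((ipderiv α (fun y => ν * ∑ j, pderiv j (pderiv j fun z => u τ z i) y - pderiv i (p τ) y -
              ∑ j, u τ y j * pderiv j (fun z => u τ z i) y) x -
            ipderiv α (fun y => 0 * ∑ j, pderiv j (pderiv j fun z => U τ z i) y - pderiv i (P τ) y -
              ∑ j, U τ y j * pderiv j (fun z => U τ z i) y) x) *
          ipderiv α (fun z => u τ z i - U τ z i) x)) ≤
      (A1 + A2) / R * Ebar + (ν * (9 * (M + 1) * 3 ^ M * Real.sqrt (∑ k ∈ Finset.range (M + 3), IU k)) * Real.sqrt (∑ m ∈ Finset.range (M + 1), ∫ x, ∑ i, dnormSq m (fun z => u τ z i - U τ z i) x) + (9 * (M + 1) ^ 3 * 6 ^ M * (∑ k ∈ Finset.range (M + 2), 3 ^ k * BU k)) * (∑ m ∈ Finset.range (M + 1), ∫ x, ∑ i, dnormSq m (fun z => u τ z i - U τ z i) x) + (9 * M * (M + 1) * 6 ^ M * 3 ^ (M + 1) * K) * Real.sqrt (∑ m ∈ Finset.range (M + 1), ∫ x, ∑ i, dnormSq m (fun z => u τ z i - U τ z i) x) ^ 3) := by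
    intro R hR τ hτ
    have hR0 : 0 < R := by linarith
    have hτ' : τ ∈ Icc 0 S := Ioo_subset_Icc_self hτ
    have hrQ : ∀ x, p τ x - P τ x = (normalisedPressure (u τ) x - normalisedPressure (U τ) x) +
        ((p τ 0 - pressurePotential (u τ) 0) - (P τ 0 - pressurePotential (U τ) 0)) := fun x => by
      rw [hQu τ hτ x, hQU τ hτ x]; ring
    have h := constantin_slice_total_pairing_le hK0 hK (hu_s τ hτ') (hU_s τ hτ') (hdivu τ hτ') (hdivU τ hτ')
      (hu.contDiff_pressure hτ') (hU.contDiff_pressure hτ') hrQ (hQmem τ hτ') (contDiff_cutoff R)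
      (hasCompactSupport_cutoff hR0) (cutoff_nonneg R) (cutoff_le_one R) hM (fun k => (hJ τ hτ' k).1) (hIbU τ hτ')
      hν hB00 (hBa τ hτ') hBb0 (hBb τ hτ') (hIB τ hτ') (div_nonneg hA0 hR0.le) (hAR1 R hR) (hAR R hR)
    have hE := constantin_errorTotal_mono (L := fun k => ∫ x, ∑ i, dnormSq k (fun z => u τ z i - U τ z i) x)
      (J := fun k => 2 * Iu k + 2 * IU k)
      (fun k => integral_nonneg fun x => Finset.sum_nonneg fun i _ => dnormSq_nonneg _ _ _)
      (fun k => (hJ τ hτ' k).2) hB00 hν (Real.sqrt_nonneg _) (hQ2 τ hτ') M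
    simp only at hE
    have hE' := mul_le_mul_of_nonneg_left hE (div_nonneg hA0 hR0.le)
    rw [hEbar]
    linarith [h, hE']
  -- the majorant is nonnegative and bounded on the slab
  have hY0 : ∀ τ, 0 ≤ (∑ m ∈ Finset.range (M + 1), ∫ x, ∑ i, dnormSq m (fun z => u τ z i - U τ z i) x) := fun τ =>
    Finset.sum_nonneg fun m _ => integral_nonneg fun x => Finset.sum_nonneg fun i _ => dnormSq_nonneg _ _ _
  have hYmax : ∀ τ ∈ Icc 0 S, (∑ m ∈ Finset.range (M + 1), ∫ x, ∑ i, dnormSq m (fun z => u τ z i - U τ z i) x) ≤ ∑ m ∈ Finset.range (M + 1), (2 * Iu m + 2 * IU m) :=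
    fun τ hτ => Finset.sum_le_sum fun m _ => (hJ τ hτ m).2
  set Ymax : ℝ := ∑ m ∈ Finset.range (M + 1), (2 * Iu m + 2 * IU m) with hYmax_def
  have hm0 : ∀ τ, 0 ≤ (ν * (9 * (M + 1) * 3 ^ M * Real.sqrt (∑ k ∈ Finset.range (M + 3), IU k)) * Real.sqrt (∑ m ∈ Finset.range (M + 1), ∫ x, ∑ i, dnormSq m (fun z => u τ z i - U τ z i) x) + (9 * (M + 1) ^ 3 * 6 ^ M * (∑ k ∈ Finset.range (M + 2), 3 ^ k * BU k)) * (∑ m ∈ Finset.range (M + 1), ∫ x, ∑ i, dnormSq m (fun z => u τ z i - U τ z i) x) + (9 * M * (M + 1) * 6 ^ M * 3 ^ (M + 1) * K) * Real.sqrt (∑ m ∈ Finset.range (M + 1), ∫ x, ∑ i, dnormSq m (fun z => u τ z i - U τ z i) x) ^ 3) := fun τ => by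
    have := hY0 τ
    have hs := Real.sqrt_nonneg (∑ m ∈ Finset.range (M + 1), ∫ x, ∑ i, dnormSq m (fun z => u τ z i - U τ z i) x)
    have hA' : 0 ≤ (9 * (M + 1) * 3 ^ M * Real.sqrt (∑ k ∈ Finset.range (M + 3), IU k)) := by positivity
    positivity
  set mbar : ℝ := ν * (9 * (M + 1) * 3 ^ M * Real.sqrt (∑ k ∈ Finset.range (M + 3), IU k)) * Real.sqrt Ymax + (9 * (M + 1) ^ 3 * 6 ^ M * (∑ k ∈ Finset.range (M + 2), 3 ^ k * BU k)) * Ymax + (9 * M * (M + 1) * 6 ^ M * 3 ^ (M + 1) * K) * Real.sqrt Ymax ^ 3 with hmbar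
  have hmle : ∀ τ ∈ Icc 0 S, (ν * (9 * (M + 1) * 3 ^ M * Real.sqrt (∑ k ∈ Finset.range (M + 3), IU k)) * Real.sqrt (∑ m ∈ Finset.range (M + 1), ∫ x, ∑ i, dnormSq m (fun z => u τ z i - U τ z i) x) + (9 * (M + 1) ^ 3 * 6 ^ M * (∑ k ∈ Finset.range (M + 2), 3 ^ k * BU k)) * (∑ m ∈ Finset.range (M + 1), ∫ x, ∑ i, dnormSq m (fun z => u τ z i - U τ z i) x) + (9 * M * (M + 1) * 6 ^ M * 3 ^ (M + 1) * K) * Real.sqrt (∑ m ∈ Finset.range (M + 1), ∫ x, ∑ i, dnormSq m (fun z => u τ z i - U τ z i) x) ^ 3) ≤ mbar := by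
    intro τ hτ
    have h1 : Real.sqrt (∑ m ∈ Finset.range (M + 1), ∫ x, ∑ i, dnormSq m (fun z => u τ z i - U τ z i) x) ≤ Real.sqrt Ymax := Real.sqrt_le_sqrt (hYmax τ hτ)
    have h2 := hYmax τ hτ
    have hA' : 0 ≤ (9 * (M + 1) * 3 ^ M * Real.sqrt (∑ k ∈ Finset.range (M + 3), IU k)) := by positivity
    rw [hmbar]
    gcongr
  -- time integration at radius `R ≥ 1`
  set Λ : ℝ≥0∞ := ∫⁻ τ in Ioo 0 t, ENNReal.ofReal (ν * (9 * (M + 1) * 3 ^ M * Real.sqrt (∑ k ∈ Finset.range (M + 3), IU k)) * Real.sqrt (∑ m ∈ Finset.range (M + 1), ∫ x, ∑ i, dnormSq m (fun z => u τ z i - U τ z i) x) + (9 * (M + 1) ^ 3 * 6 ^ M * (∑ k ∈ Finset.range (M + 2), 3 ^ k * BU k)) * (∑ m ∈ Finset.range (M + 1), ∫ x, ∑ i, dnormSq m (fun z => u τ z i - U τ z i) x) + (9 * M * (M + 1) * 6 ^ M * 3 ^ (M + 1) * K) * Real.sqrt (∑ m ∈ Finset.range (M + 1), ∫ x, ∑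 i, dnormSq m (fun z => u τ z i - U τ z i) x) ^ 3) with hΛ
  have hΛfin : Λ ≠ ⊤ := by
    refine ne_top_of_le_ne_top (b := ∫⁻ _ in Ioo (0 : ℝ) t, ENNReal.ofReal mbar) ?_ ?_
    · rw [setLIntegral_const, Real.volume_Ioo]
      exact ENNReal.mul_ne_top ENNReal.ofReal_ne_top ENNReal.ofReal_ne_top
    · exact setLIntegral_mono' measurableSet_Ioo fun τ hτ =>
        ENNReal.ofReal_le_ofReal (hmle τ ⟨hτ.1.le, hτ.2.le.trans ht.2⟩)
  have hR : ∀ R : ℝ, 1 ≤ R →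
      ∑ n ∈ Finset.range (M + 1), ∑ α : Fin n → Fin 3, ∑ i,
        ∫ x, cutoff R x * ipderiv α (fun z => u t z i - U t z i) x ^ 2 ≤
      2 * (Λ.toReal + (A1 + A2) * Ebar * S / R) := by
    intro R hR1
    have hR0 : 0 < R := by linarith
    rw [constantin_sum_integral_cutoff_sq_eq hu hU hS h0 hR0 M ht]
    refine mul_le_mul_of_nonneg_left ?_ (by norm_num)
    -- the integrand as a function of `τ`
    set Φ : ℝ → ℝ := fun τ => (∑ n ∈ Finset.range (M + 1), ∑ α : Fin n → Fin 3, ∑ i, ∫ x, cutoff R x *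
        ((ipderiv α (fun y => ν * ∑ j, pderiv j (pderiv j fun z => u τ z i) y - pderiv i (p τ) y -
              ∑ j, u τ y j * pderiv j (fun z => u τ z i) y) x -
            ipderiv α (fun y => 0 * ∑ j, pderiv j (pderiv j fun z => U τ z i) y - pderiv i (P τ) y -
              ∑ j, U τ y j * pderiv j (fun z => U τ z i) y) x) *
          ipderiv α (fun z => u τ z i - U τ z i) x)) with hΦ
    -- integrability of `Φ` on `(0, t)` through the time-derivative form
    have iΦ : IntegrableOn Φ (Ioo 0 t) := by
      have hF : ∀ n (α : Fin n → Fin 3) i, IntegrableOn (fun τ => ∫ x, cutoff R x *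
          (timeDerivWithin (Icc 0 S) (fun s y => ipderiv α (fun z => u s z i - U s z i) y) τ x *
            ipderiv α (fun z => u τ z i - U τ z i) x)) (Ioo 0 t) := fun n α i =>
        ((((constantin_continuousOn_integral_cutoff_pairing hu hU hS hR0 α i).mono
          (Icc_subset_Icc le_rfl ht.2)).integrableOn_compact isCompact_Icc).mono_set Ioo_subset_Icc_self)
      have hsumF : IntegrableOn (fun τ => ∑ n ∈ Finset.range (M + 1), ∑ α : Fin n → Fin 3, ∑ i,
          ∫ x, cutoff R x *
            (timeDerivWithin (Icc 0 S) (fun s y => ipderiv α (fun z => u s z i - U s z i) y) τ x *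
              ipderiv α (fun z => u τ z i - U τ z i) x)) (Ioo 0 t) :=
        integrable_finsetSum _ fun n _ => integrable_finsetSum _ fun α _ => integrable_finsetSum _ fun i _ => hF n α i
      refine hsumF.congr_fun (fun τ hτ => ?_) measurableSet_Ioo
      have hτ' : τ ∈ Icc 0 S := ⟨hτ.1.le, hτ.2.le.trans ht.2⟩
      rw [hΦ]
      refine Finset.sum_congr rfl fun n _ => Finset.sum_congr rfl fun α _ => Finset.sum_congr rfl fun i _ => ?_
      refine integral_congr_ae (Eventually.of_forall fun x => ?_)
      simp only
      rw [constantin_timeDerivWithin_ipderiv_sub_eq hu hU hS α i hτ' x]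
    have hER : 0 ≤ (A1 + A2) / R * Ebar := mul_nonneg (div_nonneg hA0 hR0.le) hE0
    have h1 : ∫ τ in Ioo 0 t, Φ τ ≤ (∫⁻ τ in Ioo 0 t, ENNReal.ofReal (Φ τ)).toReal :=
      integral_le_toReal_lintegral_ofReal iΦ
    have h2 : ∫⁻ τ in Ioo 0 t, ENNReal.ofReal (Φ τ) ≤ Λ + ENNReal.ofReal ((A1 + A2) / R * Ebar) * ENNReal.ofReal t := by
      calc ∫⁻ τ in Ioo 0 t, ENNReal.ofReal (Φ τ)
          ≤ ∫⁻ τ in Ioo 0 t, (ENNReal.ofReal (ν * (9 * (M + 1) * 3 ^ M * Real.sqrt (∑ k ∈ Finset.range (M + 3), IU k)) * Real.sqrt (∑ m ∈ Finset.range (M + 1), ∫ x, ∑ i, dnormSq m (fun z => u τ z i - U τ z i) x) + (9 * (M + 1) ^ 3 * 6 ^ M * (∑ k ∈ Finset.range (M + 2), 3 ^ k * BU k)) * (∑ m ∈ Finset.range (M + 1), ∫ x, ∑ i, dnormSq m (fun z => u τ z i - U τ z i) x) + (9 * M * (M + 1) * 6 ^ M * 3 ^ (M + 1) * K) * Real.sqrt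 (∑ m ∈ Finset.range (M + 1), ∫ x, ∑ i, dnormSq m (fun z => u τ z i - U τ z i) x) ^ 3) + ENNReal.ofReal ((A1 + A2) / R * Ebar)) :=
            setLIntegral_mono' measurableSet_Ioo fun τ hτ => by
              have hτS : τ ∈ Ioo 0 S := ⟨hτ.1, hτ.2.trans_le ht.2⟩
              rw [← ENNReal.ofReal_add (hm0 τ) hER]
              refine ENNReal.ofReal_le_ofReal ?_
              have := hslice R hR1 τ hτS
              rw [hΦ]
              linarith
        _ = Λ + ∫⁻ _ in Ioo (0 : ℝ) t, ENNReal.ofReal ((A1 + A2) / R * Ebar) :=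
            lintegral_add_right' _ aemeasurable_const
        _ = Λ + ENNReal.ofReal ((A1 + A2) / R * Ebar) * ENNReal.ofReal t := by
            rw [setLIntegral_const, Real.volume_Ioo, sub_zero]
    have h3 : (∫⁻ τ in Ioo 0 t, ENNReal.ofReal (Φ τ)).toReal ≤ Λ.toReal + (A1 + A2) / R * Ebar * t := by
      have hfin : Λ + ENNReal.ofReal ((A1 + A2) / R * Ebar) * ENNReal.ofReal t ≠ ⊤ :=
        ENNReal.add_ne_top.2 ⟨hΛfin, ENNReal.mul_ne_top ENNReal.ofReal_ne_top ENNReal.ofReal_ne_top⟩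
      calc (∫⁻ τ in Ioo 0 t, ENNReal.ofReal (Φ τ)).toReal
          ≤ (Λ + ENNReal.ofReal ((A1 + A2) / R * Ebar) * ENNReal.ofReal t).toReal := ENNReal.toReal_mono hfin h2
        _ = Λ.toReal + (A1 + A2) / R * Ebar * t := by
            rw [ENNReal.toReal_add hΛfin (ENNReal.mul_ne_top ENNReal.ofReal_ne_top ENNReal.ofReal_ne_top),
              ENNReal.toReal_mul, ENNReal.toReal_ofReal hER, ENNReal.toReal_ofReal ht.1]
    have h4 : (A1 + A2) / R * Ebar * t ≤ (A1 + A2) * Ebar * S / R := by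
      rw [div_mul_eq_mul_div, div_mul_eq_mul_div]
      exact div_le_div_of_nonneg_right (mul_le_mul_of_nonneg_left ht.2 (mul_nonneg hA0 hE0)) hR0.le
    have h5 : ∫ τ in Ioo 0 t, Φ τ ≤ Λ.toReal + (A1 + A2) * Ebar * S / R := by linarith
    rw [hΦ] at h5
    exact h5
  -- remove the cutoff at time `t`
  have hlim1 := constantin_tendsto_sum_integral_cutoff_sq (hw_s t ht) (fun m => (hJ t ht m).1) M
  have hlim2 : Tendsto (fun R : ℝ => 2 * (Λ.toReal + (A1 + A2) * Ebar * S / R)) atTop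
      (nhds (2 * (Λ.toReal + 0))) := by
    refine Tendsto.const_mul 2 (tendsto_const_nhds.add ?_)
    simpa using (tendsto_const_nhds (x := (A1 + A2) * Ebar * S)).div_atTop tendsto_id
  rw [add_zero] at hlim2
  have hfinal := le_of_tendsto_of_tendsto hlim1 hlim2 (eventually_atTop.2 ⟨1, hR⟩)
  rw [constantin_sum_levels_eq_sum_words (hw_s t ht) (fun m => (hJ t ht m).1) M]
  exact hfinal

end Energy

end Literature.Analysis.FluidPDE

end
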